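import Literature.NumberTheory.LFunctions.RealZerosPintzLandau
import Literature.NumberTheory.LFunctions.RealZerosRealLFunctionsElementaryProofs
import HarnessLib

/-!
# Pintz 1977 (VIII), Theorem 6 (Tatuzawa, constants `1/7`, `1/35`) and Theorem 7 — PROVED

Topic `Literature/NumberTheory/LFunctions` (namespace `Literature.NumberTheory.LFunctions`, helpers
in the grouping sub-namespace `Pintz1977RealZeros`). PROOF LAYER for the statement file
`RealZerosRealLFunctionsElementary.lean` (cells `parity-realchar` / `landau-siegel` §C); third part
after `RealZerosPintzContinuation.lean` (Theorem 4; the engine = Lemmata 2–3 and §4) and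
`RealZerosPintzLandau.lean` (Theorem 5; Lemma 1 for `j = 3`). The named facts

* `pintz1977RealZeros_theorem6` — J. Pintz, *Elementary methods in the theory of `L`-functions,
  VIII. Real zeros of real `L`-functions*, Acta Arith. **33** (1977) 89–98, Theorem 6 (Tatuzawa):
  "If `0 < ε ≤ 1/5`, `χ` is a real primitive character `(mod D)`, where `D ≥ D₀` (absolute effective
  constant) then (2.1) `L(s, χ) ≠ 0` for `s ∈ [1 − ε/7D^ε, 1]` and (2.2) `L(1, χ) > ε/35D^ε`, with
  the possible exception not more then one `D`, and one real primitive character `(mod D)`";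
* `pintz1977RealZeros_theorem7a`, `pintz1977RealZeros_theorem7b` — Theorem 7, (2.3) and (2.4)
  (class numbers of imaginary quadratic fields),

are discharged here: `pintz1977RealZeros_theorem6_holds` by the printed proof, and
`pintz1977RealZeros_theorem7a_holds`, `pintz1977RealZeros_theorem7b_holds` by the bridges
`Pintz1977RealZeros.theorem7a_of_theorem6`, `Pintz1977RealZeros.theorem7b_of_theorem7a` already
proved in the statement file (Dirichlet's class number formula; the printed computation (4.10)). The
statement file is untouched; the typed `Prop`s are proved literally. Everything in this file is
PROVED (theorems only; no definition, no named fact).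

## Source and road (as printed, pp. 95–97)

Source READ first-hand in the proving seat: the journal scan `matwbn.icm.edu.pl/ksiazki/aa/aa33/aa3318.pdf`
(corpus `paper:url-e87e20b34ffd`; Theorem 6 p. 90, Lemma 2 (3.12) p. 93, (4.1)–(4.3) p. 95, proof
of Theorem 6 pp. 96–97).

PRINT (pp. 96–97): "Let `D₁` be the minimal modulus (`≥ D₀` absolute constant) for which there
exists a real primitive character `χ₁` with a Siegel zero `1 − γ`, where `γ < ε/7D₁^ε`. Let
`D₂ ≥ D₁` another modulus, `χ₂` a real primitive character `(mod D₂)` (`χ₂ ≠ χ₁`) for which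
`L(1 − δ, χ₂) = 0`. Let `D = D₁D₂`, `x = D³` (`≤ D₂⁶`). We shall use that `τx^{−τ}` is maximal for
`τ = 1/log x`, and is monotonically decreasing for `τ > 1/log x`. We shall further use that by
Theorem 5 if `D₂ ≥ D₀`, `D₁ ≥ D₀` then (4.6) `max(γ, δ) > 1/(3 log D)`. Thus in case of `δ ≥ γ` we
have (4.7) `δ > 1/(3 log D) > 1/(2e log D) ≥ (ε/2)/(2D^{ε/2}) > ε/7D₂^ε`. Let us assume `δ ≤ γ`. Then
(4.8) `ε/6 > γ > 1/(3 log D) = 1/log x`. Now let us regard `F(s) = F(s, χ₁, χ₂)`. From (4.3) …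
using (4.8) and `x^{1/6} ≤ D₂` we get (4.9)
`δ ≥ (1 + o(1))γ/x^γ ≥ (6/7) γ/x^γ ≥ (6/7)(ε/6)/x^{ε/6} ≥ ε/7D₂^ε`. As `ε/7D^ε ≤ 1/(7e log D) < 1/log D`
and `e^{3/2} < 5` on applying Theorem 2 (2.2) follows directly from (4.9)." Here (4.1)–(4.3)
(p. 95, proof of Theorem 1): for `F(1 − τ) = 0`, Lemma 2 gives
`(1 + o(1)) ∑_{m ≤ x} f(m) m^{−(1−τ)} = (a/τ) x^τ`; applied with `τ = δ` and `τ = γ`, `δ ≤ γ`, `f ≥ 0`: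
`(1 + o(1))(a/γ)x^γ = ∑ f(m)m^{−(1−γ)} ≥ ∑ f(m)m^{−(1−δ)} = (1 + o(1))(a/δ)x^δ`, so
`δ ≥ (1 + o(1))γ/x^γ`.

HERE, in the same order:

* **Part A (Lemma 2 (3.12) at a real point, engine form).** For `f ≥ 0` with
  `∑_{k ≤ t} f(k) = at + R(t)`, `|R(t)| ≤ B₀t^{1−κ}`: Abel summation against `t^{−σ}` on `[1, N]`
  (`sum_mul_rpow_neg_eq`, Mathlib `sum_mul_eq_sub_integral_mul₀'`) and the split `∫_1^∞ = ∫_1^N + ∫_N^∞`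
  give `∑_{k ≤ N} f(k)k^{−σ} = Φ(σ) + aN^{1−σ}/(1−σ) + R(N)N^{−σ} − σ∫_N^∞ R(t)t^{−σ−1} dt`,
  `Φ(σ) = aσ/(σ−1) + σ∫_1^∞ R t^{−σ−1}` (`sum_mul_rpow_neg_eq_continuation`), with the tail bounds
  `B N^{−α}`, `B N^{−α}/α`, `α = σ + κ − 1` (`abs_tail_le'`).
* **Part B ((4.1)).** For `F = ζL(χ₁)L(χ₂)L(χ₁χ₂)` the engine of `RealZerosPintzContinuation`
  (`continuation_eq`: `F(σ) = Φ(σ)` on `σ > 1 − κ`) and Lemma 1 (`j = 3`) of `RealZerosPintzLandau`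
  (`norm_summatory_coeff_sub_le`, `κ = 1/4 − δ'`) give, at a real zero `1 − τ` of `F`,
  `|∑_{k ≤ N} r(k)k^{−(1−τ)} − aN^τ/τ| ≤ B N^{−(1/4−δ'−τ)}(1 + 1/(1/4−δ'−τ))` (`landau_sum_rpow_of_zero`).
* **Part C (the core, (4.6)–(4.9)).** `tatuzawa_core`: the printed case distinction, with the
  elementary facts `τx^{−τ} ≤ 1/(e log x)` (`mul_rpow_neg_le_inv_log`) and the monotonicity of
  `τx^{−τ}` for `τ ≥ 1/log x` (`mul_rpow_neg_le_mul_rpow_neg`); in case (4.9) the two instances of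
  Part B at `τ = γ, δ` with error `≤ 1/25` give `δ ≥ (12/13)γx^{−γ} ≥ (2/13)ε D₂^{−ε} > ε/7D₂^ε`.
* **Part D–E (Theorem 6, Theorem 7).** The absolute `D₀` is the maximum of the threshold of the
  landed Theorem 5 at `η = 2/3` (`c′ = 1/3`), of the window conditions at `x = D³` (divisor bound
  `τ(n) ≤ Cn^{1/80}`, `δ' = 1/80`; `exists_tatuzawa_conditions_nat`) and of Hecke's `⌈e^{10000}⌉`
  (tree `re_LFunction_one_ge_of_forall_ne_zero`, kernel form of Theorem 2: `0.29 β ≤ L(1, χ)`); the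
  exceptional value function is that of a character of minimal modulus carrying a zero in
  `[1 − ε/(7D^ε), 1]` (`Nat.find`); minimality gives `D₁ ≤ D` for any other offender, and Part C the
  contradiction; (2.2) from (2.1) by Hecke with `β = ε/7D^ε ≤ 1/(7e log D)` and `0.29/7 > 1/35`
  (`re_LFunction_one_gt_of_zeroFree`). Theorems 7a/7b: the bridges of the statement file.

DECLARED DEVIATIONS from print: (i) the printed `(1 + o(1)) ≥ 6/7` in (4.9) is realised as the
explicit `12/13` (Lemma-2 errors `≤ 1/25` at `x = D³`), giving `(2/13)εD₂^{−ε} > ε/7D₂^ε`; (ii) the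
partial-sum bounds and the Lemma-1 error are those of `RealZerosPintzLandau` (Pólya–Vinogradov
`√q(1+log q)`, `τ(q)√q(1+log q)` for `χ₁χ₂`, `54ℓ²A^{1/4}y^{3/4}(1+log y)²`), not `A = (D₁D₂)²`,
`j = 3` of p. 95 — any `A = D^{O(1)}` with `x = D³`, `τ ≤ 1/20` makes the error `o(1)`; (iii) Hecke's
theorem enters through the tree's kernel version with constant `0.29` and threshold `⌈e^{10000}⌉`
(so `D₀` is explicit but astronomically large; the print only claims "absolute effective");
(iv) the case "`δ ≥ γ`"/"`δ ≤ γ`" is cut at `δ > 1/(3 log D)` instead, which is what (4.7)–(4.8) use.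
No constant of the printed statement is changed: `1/7`, `1/35`, one exceptional character, `D₀`
absolute.

WHAT THIS IS NOT: no claim that an exceptional character exists or does not exist; nothing here
bears on parity or on Landau–Siegel zeros beyond Tatuzawa's classical theorem. «The programme
SEARCHES and TYPES; no claim about Landau–Siegel zeros, Theorems 1–2 of arXiv:2211.02515 or a
repaired Margin232 until a kernel theorem says so.»

## References

* [Pintz1977ElementaryVIII] J. Pintz, Acta Arith. 33 (1977) 89–98: Theorems 6–7 pp. 90–91; Lemma 2
  (3.12)–(3.15) pp. 93–94; (4.1)–(4.3) p. 95; proof of Theorem 6, (4.6)–(4.9) pp. 96–97; (4.10) p. 97.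
* [MontgomeryVaughan2007] H. L. Montgomery, R. C. Vaughan, *Multiplicative Number Theory I*, CUP
  2007: §11.2 (Landau, Siegel; p. 285 the coefficients of `ζL₁L₂L₃`).
* [Tatuzawa1951] T. Tatuzawa, *On a theorem of Siegel*, Jap. J. Math. 21 (1951) 163–178 (the
  original of Theorem 6; tree `TatuzawaTheorem.lean` has MV's inexplicit-constant version).
-/

noncomputable section

open Complex Filter Topology Set MeasureTheory Finset Asymptotics ArithmeticFunction
open scoped ArithmeticFunction.zeta

namespace Literature.NumberTheory.LFunctions

namespace Pintz1977RealZeros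

/-! ## Part A. Pintz's Lemma 2 (3.12) at a real point `σ < 1`: the engine identity and bound -/

section EngineRealPoint

variable {f : ℕ → ℝ} {a B₀ κ : ℝ} {R : ℝ → ℝ} {I : ℂ → ℂ}

/-- Abel summation of the summatory function against the weight `t^{−σ}` on `[1, N]`:
`∑_{k ≤ N} f(k) k^{−σ} = N^{−σ} H(N) + σ ∫_1^N H(t) t^{−σ−1} dt` (`f(0) = 0`).
[cite: Pintz1977ElementaryVIII, Lemma 2 (3.13)–(3.14) p. 94] -/
theorem sum_mul_rpow_neg_eq (hf0 : f 0 = 0) (σ : ℝ) {N : ℕ} (hN : 1 ≤ N) :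
    ∑ k ∈ Icc 1 N, f k * (k : ℝ) ^ (-σ) =
      (N : ℝ) ^ (-σ) * (∑ k ∈ Icc 1 N, f k) +
        σ * ∫ t in Ioc (1 : ℝ) N, (∑ k ∈ Icc 1 ⌊t⌋₊, f k) * t ^ (-(σ + 1)) := by
  have hN1 : (1 : ℝ) ≤ N := by exact_mod_cast hN
  have hderiv : ∀ t ∈ Set.Icc (1 : ℝ) N,
      HasDerivAt (fun t : ℝ => t ^ (-σ)) (-σ * t ^ (-(σ + 1))) t := by
    intro t ht
    have ht0 : 0 < t := zero_lt_one.trans_le ht.1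
    have h := Real.hasDerivAt_rpow_const (p := -σ) (Or.inl ht0.ne')
    refine h.congr_deriv ?_
    rw [show -σ - 1 = -(σ + 1) by ring]
  have hdiff : ∀ t ∈ Set.Icc (1 : ℝ) N, DifferentiableAt ℝ (fun t : ℝ => t ^ (-σ)) t :=
    fun t ht => (hderiv t ht).differentiableAt
  have hcont : ContinuousOn (fun t : ℝ => -σ * t ^ (-(σ + 1))) (Set.Icc (1 : ℝ) N) :=
    continuousOn_const.mul
      (ContinuousOn.rpow_const continuousOn_id fun t ht => Or.inl (zero_lt_one.trans_le ht.1).ne')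
  have hderiv_eq : Set.EqOn (deriv fun t : ℝ => t ^ (-σ)) (fun t : ℝ => -σ * t ^ (-(σ + 1)))
      (Set.Icc (1 : ℝ) N) := fun t ht => (hderiv t ht).deriv
  have hint : IntegrableOn (deriv fun t : ℝ => t ^ (-σ)) (Set.Icc (1 : ℝ) N) :=
    (hcont.integrableOn_Icc).congr_fun hderiv_eq.symm measurableSet_Icc
  have habel := sum_mul_eq_sub_integral_mul₀' (c := f) (f := fun t : ℝ => t ^ (-σ)) hf0 N hdiff hint
  have hIcc : ∀ (n : ℕ) (g : ℕ → ℝ), ∑ k ∈ Icc 0 n, g k * f k = ∑ k ∈ Icc 1 n, g k * f k := by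
    intro n g
    refine (Finset.sum_subset (fun k hk => ?_) (fun k hk hk' => ?_)).symm
    · simp only [Finset.mem_Icc] at hk ⊢; omega
    · simp only [Finset.mem_Icc, not_and, not_le] at hk hk'
      have : k = 0 := by omega
      rw [this, hf0, mul_zero]
  have hIcc1 : ∀ n : ℕ, ∑ k ∈ Icc 0 n, f k = ∑ k ∈ Icc 1 n, f k := by
    intro n
    have := hIcc n (fun _ => 1)
    simpa using this
  rw [hIcc, hIcc1] at habel
  simp_rw [hIcc1] at habel
  have hint_eq : ∫ t in Ioc (1 : ℝ) N, deriv (fun t : ℝ => t ^ (-σ)) t * ∑ k ∈ Icc 1 ⌊t⌋₊, f k =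
      -σ * ∫ t in Ioc (1 : ℝ) N, (∑ k ∈ Icc 1 ⌊t⌋₊, f k) * t ^ (-(σ + 1)) := by
    rw [← integral_const_mul]
    refine setIntegral_congr_fun measurableSet_Ioc fun t ht => ?_
    rw [hderiv_eq ⟨ht.1.le, ht.2⟩]; ring
  have e : ∑ k ∈ Icc 1 N, f k * (k : ℝ) ^ (-σ) = ∑ k ∈ Icc 1 N, (k : ℝ) ^ (-σ) * f k :=
    Finset.sum_congr rfl fun k _ => by ring
  rw [e, habel, hint_eq]
  ring

/-- `∫_1^N a t · t^{−σ−1} dt = a (N^{1−σ} − 1)/(1 − σ)` (`σ ≠ 1`). [folklore] -/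
private theorem integral_linear_mul_rpow_neg (a : ℝ) {σ : ℝ} (hσ1 : σ ≠ 1) {N : ℕ} (hN : 1 ≤ N) :
    ∫ t in Ioc (1 : ℝ) N, a * t * t ^ (-(σ + 1)) = a * (((N : ℝ) ^ (1 - σ) - 1) / (1 - σ)) := by
  have hN1 : (1 : ℝ) ≤ N := by exact_mod_cast hN
  have h1σ : (1 - σ) ≠ 0 := sub_ne_zero.mpr (Ne.symm hσ1)
  have heq : ∫ t in Ioc (1 : ℝ) N, a * t * t ^ (-(σ + 1)) = ∫ t in Ioc (1 : ℝ) N, a * t ^ (-σ) := by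
    refine setIntegral_congr_fun measurableSet_Ioc fun t ht => ?_
    have ht0 : 0 < t := zero_lt_one.trans ht.1
    rw [mul_assoc, show t * t ^ (-(σ + 1)) = t ^ (-σ) by
      rw [show -(σ + 1) = -σ - 1 by ring, Real.rpow_sub_one ht0.ne']; field_simp]
  rw [heq, integral_const_mul, ← intervalIntegral.integral_of_le hN1,
    integral_rpow (Or.inr ⟨fun h => hσ1 (by linarith), by
      rw [Set.uIcc_of_le hN1]; exact fun h => by rw [Set.mem_Icc] at h; linarith [h.1]⟩)]
  rw [Real.one_rpow, show -σ + 1 = 1 - σ by ring]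

/-- **Lemma 2 (3.12) at a real point**: for `1 − κ < σ < 1` and a natural number `N ≥ 1`,
`∑_{k ≤ N} f(k) k^{−σ} = Φ(σ) + a N^{1−σ}/(1−σ) + R(N) N^{−σ} − σ ∫_N^∞ R(t) t^{−σ−1} dt`, where
`Φ(σ) = aσ/(σ−1) + σ ∫_1^∞ R(t) t^{−σ−1} dt` is (the real form of) the continued function.
[cite: Pintz1977ElementaryVIII, Lemma 2 (3.12)–(3.14) pp. 93–94] -/
theorem sum_mul_rpow_neg_eq_continuation (hf0 : f 0 = 0)
    (hR : ∀ t, R t = (∑ k ∈ Icc 1 ⌊t⌋₊, f k) - a * t)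
    (hRb : ∀ t : ℝ, 1 ≤ t → |R t| ≤ B₀ * t ^ (1 - κ))
    (hI : ∀ s, I s = ∫ t in Ioi (1 : ℝ), ((R t : ℝ) : ℂ) * (t : ℂ) ^ (-(s + 1)))
    {σ : ℝ} (hσ : 1 - κ < σ) (hσ1 : σ < 1) {N : ℕ} (hN : 1 ≤ N) :
    ∑ k ∈ Icc 1 N, f k * (k : ℝ) ^ (-σ) =
      (a * σ / (σ - 1) + σ * ∫ t in Ioi (1 : ℝ), R t * t ^ (-(σ + 1))) +
        a * (N : ℝ) ^ (1 - σ) / (1 - σ) + R N * (N : ℝ) ^ (-σ) -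
        σ * ∫ t in Ioi (N : ℝ), R t * t ^ (-(σ + 1)) := by
  have hN1 : (1 : ℝ) ≤ N := by exact_mod_cast hN
  have hN0 : (0 : ℝ) < N := by positivity
  have hσ1' : σ ≠ 1 := hσ1.ne
  have h1σ : (1 - σ) ≠ 0 := sub_ne_zero.mpr (Ne.symm hσ1')
  have hσm1 : (σ - 1) ≠ 0 := sub_ne_zero.mpr hσ1'
  obtain ⟨hJ0, -⟩ := integrableOn_remainder_real hR hRb hI hσ
  -- split `∫_1^∞ = ∫_1^N + ∫_N^∞`
  have hsplit : ∫ t in Ioi (1 : ℝ), R t * t ^ (-(σ + 1)) =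
      (∫ t in Ioc (1 : ℝ) N, R t * t ^ (-(σ + 1))) + ∫ t in Ioi (N : ℝ), R t * t ^ (-(σ + 1)) := by
    rw [← setIntegral_union (Set.Ioc_disjoint_Ioi le_rfl) measurableSet_Ioi
      (hJ0.mono_set Set.Ioc_subset_Ioi_self) (hJ0.mono_set (Set.Ioi_subset_Ioi hN1)),
      Set.Ioc_union_Ioi_eq_Ioi hN1]
  -- `∫_1^N H t^{−σ−1} = ∫_1^N a t·t^{−σ−1} + ∫_1^N R t^{−σ−1}`
  have hHsplit : ∫ t in Ioc (1 : ℝ) N, (∑ k ∈ Icc 1 ⌊t⌋₊, f k) * t ^ (-(σ + 1)) =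
      (∫ t in Ioc (1 : ℝ) N, a * t * t ^ (-(σ + 1))) + ∫ t in Ioc (1 : ℝ) N, R t * t ^ (-(σ + 1)) := by
    have hi1 : IntegrableOn (fun t : ℝ => a * t * t ^ (-(σ + 1))) (Ioc (1 : ℝ) N) := by
      refine (ContinuousOn.integrableOn_Icc ?_).mono_set Set.Ioc_subset_Icc_self
      refine (continuousOn_const.mul continuousOn_id).mul ?_
      exact ContinuousOn.rpow_const continuousOn_id fun t ht => Or.inl (zero_lt_one.trans_le ht.1).ne'
    rw [← integral_add hi1 (hJ0.mono_set Set.Ioc_subset_Ioi_self)]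
    refine setIntegral_congr_fun measurableSet_Ioc fun t _ => ?_
    rw [hR]; ring
  have hRN : R N = (∑ k ∈ Icc 1 N, f k) - a * N := by rw [hR, Nat.floor_natCast]
  have hsum : ∑ k ∈ Icc 1 N, f k = a * N + R N := by rw [hRN]; ring
  rw [sum_mul_rpow_neg_eq hf0 σ hN, hHsplit, integral_linear_mul_rpow_neg a hσ1' hN, hsplit, hsum]
  have e1 : (N : ℝ) ^ (1 - σ) = (N : ℝ) * (N : ℝ) ^ (-σ) := by
    rw [show (1 - σ) = 1 + (-σ) by ring, Real.rpow_add hN0, Real.rpow_one]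
  rw [e1]
  field_simp
  ring

/-- The plain tail bound: if `|R(t)| ≤ B t^{1−κ}` for `t ≥ N` (`N ≥ 1`) and `α = σ + κ − 1 > 0`, then
`|R(N)| N^{−σ} ≤ B N^{−α}` and `|∫_N^∞ R(t) t^{−σ−1} dt| ≤ B N^{−α}/α`.
[cite: Pintz1977ElementaryVIII, Lemma 2 (3.15) p. 94] -/
theorem abs_tail_le' {B : ℝ} {N : ℕ} (hN : 1 ≤ N)
    (hB : ∀ t : ℝ, (N : ℝ) ≤ t → |R t| ≤ B * t ^ (1 - κ))
    (hR : ∀ t, R t = (∑ k ∈ Icc 1 ⌊t⌋₊, f k) - a * t)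
    {σ : ℝ} (hα : 0 < σ + κ - 1) :
    |R N * (N : ℝ) ^ (-σ)| ≤ B * (N : ℝ) ^ (-(σ + κ - 1)) ∧
      |∫ t in Ioi (N : ℝ), R t * t ^ (-(σ + 1))| ≤ B * (N : ℝ) ^ (-(σ + κ - 1)) / (σ + κ - 1) := by
  set α := σ + κ - 1 with hαdef
  have hN1 : (1 : ℝ) ≤ N := by exact_mod_cast hN
  have hN0 : (0 : ℝ) < N := by positivity
  have hB0 : 0 ≤ B := by
    have h := hB N le_rfl
    have h1 : 0 < (N : ℝ) ^ (1 - κ) := Real.rpow_pos_of_pos hN0 _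
    nlinarith [abs_nonneg (R N)]
  refine ⟨?_, ?_⟩
  · rw [abs_mul, abs_of_pos (Real.rpow_pos_of_pos hN0 _)]
    calc |R N| * (N : ℝ) ^ (-σ) ≤ B * (N : ℝ) ^ (1 - κ) * (N : ℝ) ^ (-σ) :=
          mul_le_mul_of_nonneg_right (hB N le_rfl) (Real.rpow_nonneg hN0.le _)
      _ = B * (N : ℝ) ^ (-(σ + κ - 1)) := by
          rw [mul_assoc, ← Real.rpow_add hN0]; ring_nf
  · -- `|∫_N^∞ R t^{−σ−1}| ≤ ∫_N^∞ B t^{−α−1} = B N^{−α}/α`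
    have hmeas : Measurable R := by
      have : R = fun t => (∑ k ∈ Icc 1 ⌊t⌋₊, f k) - a * t := funext hR
      rw [this]
      refine Measurable.sub ?_ (measurable_const.mul measurable_id)
      exact (measurable_from_nat (f := fun n : ℕ => ∑ k ∈ Icc 1 n, f k)).comp Nat.measurable_floor
    have hdom : IntegrableOn (fun t : ℝ => B * t ^ (-(α + 1))) (Ioi (N : ℝ)) := by
      have := integrableOn_Ioi_rpow_of_lt (by linarith : -(α + 1) < -1) hN0
      exact this.const_mul B
    have hle : ∀ t ∈ Ioi (N : ℝ), |R t * t ^ (-(σ + 1))| ≤ B * t ^ (-(α + 1)) := by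
      intro t ht
      have htN : (N : ℝ) ≤ t := le_of_lt ht
      have ht0 : 0 < t := hN0.trans ht
      rw [abs_mul, abs_of_pos (Real.rpow_pos_of_pos ht0 _)]
      calc |R t| * t ^ (-(σ + 1)) ≤ B * t ^ (1 - κ) * t ^ (-(σ + 1)) :=
            mul_le_mul_of_nonneg_right (hB t htN) (Real.rpow_nonneg ht0.le _)
        _ = B * t ^ (-(α + 1)) := by rw [mul_assoc, ← Real.rpow_add ht0, hαdef]; ring_nf
    have hint : IntegrableOn (fun t : ℝ => R t * t ^ (-(σ + 1))) (Ioi (N : ℝ)) := by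
      refine MeasureTheory.Integrable.mono' hdom ?_ ?_
      · exact ((hmeas.mul (measurable_id.pow_const _)).aestronglyMeasurable)
      · exact (ae_restrict_iff' measurableSet_Ioi).mpr (Filter.Eventually.of_forall fun t ht => by
          rw [Real.norm_eq_abs]; exact hle t ht)
    calc |∫ t in Ioi (N : ℝ), R t * t ^ (-(σ + 1))|
        ≤ ∫ t in Ioi (N : ℝ), |R t * t ^ (-(σ + 1))| := by
          rw [← Real.norm_eq_abs]; exact (norm_integral_le_integral_norm _).trans (le_of_eq rfl)
      _ ≤ ∫ t in Ioi (N : ℝ), B * t ^ (-(α + 1)) := by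
          refine setIntegral_mono_on hint.abs hdom measurableSet_Ioi fun t ht => hle t ht
      _ = B * (N : ℝ) ^ (-(σ + κ - 1)) / (σ + κ - 1) := by
          rw [integral_const_mul, integral_Ioi_rpow_of_lt (by linarith : -(α + 1) < -1) hN0]
          rw [show -(α + 1) + 1 = -α by ring, hαdef]
          field_simp

end EngineRealPoint

/-! ## Part B. (4.1): Lemma 2 at a real zero of `F(s, χ₁, χ₂)` -/

section LandauRealPoint

open DirichletAbel RealChar SiegelCoefficients
open scoped ComplexOrder

variable {D₁ D₂ : ℕ} [NeZero D₁] [NeZero D₂] (χ₁ : DirichletCharacter ℂ D₁)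
  (χ₂ : DirichletCharacter ℂ D₂)

omit [NeZero D₁] [NeZero D₂] in
/-- The coefficients `r(n)` are real: `r(n) = Re r(n)`. [folklore] -/
private theorem ofReal_re_coeff' (h₁ : χ₁ ^ 2 = 1) (h₂ : χ₂ ^ 2 = 1) (n : ℕ) :
    (((coeff χ₁ χ₂ n).re : ℝ) : ℂ) = coeff χ₁ χ₂ n := by
  have h := Complex.nonneg_iff.mp (coeff_nonneg χ₁ χ₂ h₁ h₂ n)
  exact Complex.ext (by simp) (by simp [← h.2])

/-- `(1 + log t)² ≤ 16 t^δ/δ²` for `t ≥ 1`, `0 < δ ≤ 1`. [folklore] -/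
private theorem one_add_log_sq_le' {t δ : ℝ} (ht : 1 ≤ t) (hδ0 : 0 < δ) (hδ1 : δ ≤ 1) :
    (1 + Real.log t) ^ 2 ≤ 16 / δ ^ 2 * t ^ δ := by
  have ht0 : 0 ≤ t := by linarith
  have hlog := Real.log_le_rpow_div ht0 (half_pos hδ0)
  have hp1 : 1 ≤ t ^ (δ / 2) := Real.one_le_rpow ht (by linarith)
  have h1 : 1 + Real.log t ≤ 4 / δ * t ^ (δ / 2) := by
    have h2 : (1 : ℝ) ≤ 2 / δ * t ^ (δ / 2) := by
      have : (1 : ℝ) ≤ 2 / δ := by rw [le_div_iff₀ hδ0]; linarith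
      nlinarith
    have h3 : Real.log t ≤ 2 / δ * t ^ (δ / 2) := by
      rw [show 2 / δ * t ^ (δ / 2) = t ^ (δ / 2) / (δ / 2) by field_simp]
      exact hlog
    calc 1 + Real.log t ≤ 2 / δ * t ^ (δ / 2) + 2 / δ * t ^ (δ / 2) := add_le_add h2 h3
      _ = 4 / δ * t ^ (δ / 2) := by ring
  have h0 : 0 ≤ 1 + Real.log t := by linarith [Real.log_nonneg ht]
  calc (1 + Real.log t) ^ 2 ≤ (4 / δ * t ^ (δ / 2)) ^ 2 := pow_le_pow_left₀ h0 h1 2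
    _ = 16 / δ ^ 2 * (t ^ (δ / 2) * t ^ (δ / 2)) := by ring
    _ = 16 / δ ^ 2 * t ^ δ := by rw [← Real.rpow_add (by linarith)]; ring_nf

/-- **(4.1): Lemma 2 at a real zero `1 − τ` of `F(s, χ₁, χ₂)`** (p. 95: "if for a real `τ` …
`F(1 − τ) = 0` then we have by Lemma 2 `(1 + o(1)) ∑_{m ≤ x} f(m) m^{−(1−τ)} = (a/τ) x^τ`"), with an
explicit error: for quadratic non-principal `χ₁, χ₂` with `χ₁χ₂` non-principal, partial-sum bounds
`A₁, A₂, A₃`, `|L(1,χ_i)| ≤ ℓ`, `0 < δ ≤ 1/16`, a natural number `N ≥ A₁A₂A₃` and `0 < τ < 1/4 − δ`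
with `L(1 − τ, χ₁) = 0` or `L(1 − τ, χ₂) = 0`:
`|∑_{k ≤ N} r(k) k^{−(1−τ)} − a N^τ/τ| ≤ B N^{−(1/4−δ−τ)} (1 + 1/(1/4 − δ − τ))`,
`a = L(1,χ₁)L(1,χ₂)L(1,χ₁χ₂)`, `B = (864 ℓ²/δ²)(A₁A₂A₃)^{1/4}`.
[cite: Pintz1977ElementaryVIII, Lemma 2 (3.12) p. 93; proof of Theorem 1, (4.1) p. 95] -/
theorem landau_sum_rpow_of_zero (hχ₁ : χ₁ ≠ 1) (hq₁ : χ₁ ^ 2 = 1) (hχ₂ : χ₂ ≠ 1)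
    (hq₂ : χ₂ ^ 2 = 1) (hψ : prodChar χ₁ χ₂ ≠ 1) {A₁ A₂ A₃ ℓ δ : ℝ} (hA₁1 : 1 ≤ A₁)
    (hA₂1 : 1 ≤ A₂) (hA₃1 : 1 ≤ A₃) (hℓ1 : 1 ≤ ℓ) (hA₁ : ∀ n, ‖partialSum χ₁ n‖ ≤ A₁)
    (hA₂ : ∀ n, ‖partialSum χ₂ n‖ ≤ A₂) (hA₃ : ∀ n, ‖partialSum (prodChar χ₁ χ₂) n‖ ≤ A₃)
    (hL₁ : ‖χ₁.LFunction 1‖ ≤ ℓ) (hL₂ : ‖χ₂.LFunction 1‖ ≤ ℓ) (hδ0 : 0 < δ) (hδ : δ ≤ 1 / 16)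
    {N : ℕ} (hNA : A₁ * A₂ * A₃ ≤ N) {τ : ℝ} (hτ0 : 0 < τ) (hτ : τ < 1 / 4 - δ)
    (hz : χ₁.LFunction ((1 - τ : ℝ) : ℂ) = 0 ∨ χ₂.LFunction ((1 - τ : ℝ) : ℂ) = 0) :
    |∑ k ∈ Icc 1 N, (coeff χ₁ χ₂ k).re * (k : ℝ) ^ (-(1 - τ)) -
        ((χ₁.LFunction 1).re * (χ₂.LFunction 1).re * ((prodChar χ₁ χ₂).LFunction 1).re) *
          (N : ℝ) ^ τ / τ| ≤
      864 * ℓ ^ 2 / δ ^ 2 * (A₁ * A₂ * A₃) ^ (1 / 4 : ℝ) * (N : ℝ) ^ (-(1 / 4 - δ - τ)) *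
        (1 + 1 / (1 / 4 - δ - τ)) := by
  have hψq : prodChar χ₁ χ₂ ^ 2 = 1 := prodChar_sq_eq_one χ₁ χ₂ hq₁ hq₂
  -- the data of the engine (kept opaque)
  obtain ⟨f, hfdef⟩ : ∃ f : ℕ → ℝ, ∀ n, f n = (coeff χ₁ χ₂ n).re := ⟨_, fun _ => rfl⟩
  set L₁ : ℂ := χ₁.LFunction 1 with hL₁def
  set L₂ : ℂ := χ₂.LFunction 1 with hL₂def
  set L₃ : ℂ := (prodChar χ₁ χ₂).LFunction 1 with hL₃def
  obtain ⟨a, hadef⟩ : ∃ a : ℝ, a = L₁.re * L₂.re * L₃.re := ⟨_, rfl⟩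
  obtain ⟨R, hR⟩ : ∃ R : ℝ → ℝ, ∀ t, R t = (∑ k ∈ Icc 1 ⌊t⌋₊, f k) - a * t := ⟨_, fun _ => rfl⟩
  obtain ⟨I, hI⟩ : ∃ I : ℂ → ℂ,
      ∀ s, I s = ∫ t in Ioi (1 : ℝ), ((R t : ℝ) : ℂ) * (t : ℂ) ^ (-(s + 1)) := ⟨_, fun _ => rfl⟩
  have hfC : ∀ n, ((f n : ℝ) : ℂ) = coeff χ₁ χ₂ n := fun n => by
    rw [hfdef]; exact ofReal_re_coeff' χ₁ χ₂ hq₁ hq₂ n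
  have hf : ∀ n, 0 ≤ f n := fun n => by
    rw [hfdef]; exact (Complex.nonneg_iff.mp (coeff_nonneg χ₁ χ₂ hq₁ hq₂ n)).1
  have hf0 : f 0 = 0 := by rw [hfdef]; simp
  -- `a = L(1,χ₁)L(1,χ₂)L(1,χ₁χ₂) > 0`
  have hL₁re : L₁ = ((L₁.re : ℝ) : ℂ) := by
    have := LFunction_ofReal_eq_re χ₁ hχ₁ hq₁ one_pos; rwa [ofReal_one] at this
  have hL₂re : L₂ = ((L₂.re : ℝ) : ℂ) := by
    have := LFunction_ofReal_eq_re χ₂ hχ₂ hq₂ one_pos; rwa [ofReal_one] at this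
  have hL₃re : L₃ = ((L₃.re : ℝ) : ℂ) := by
    have := LFunction_ofReal_eq_re (prodChar χ₁ χ₂) hψ hψq one_pos; rwa [ofReal_one] at this
  have haC : ((a : ℝ) : ℂ) = L₁ * L₂ * L₃ := by
    rw [hadef, hL₁re, hL₂re, hL₃re]; push_cast; simp
  have ha : 0 < a := by
    rw [hadef]
    exact mul_pos (mul_pos (Siegel.LFunction_one_re_pos χ₁ hχ₁ hq₁)
      (Siegel.LFunction_one_re_pos χ₂ hχ₂ hq₂)) (Siegel.LFunction_one_re_pos _ hψ hψq)
  -- numerics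
  have hA₁0 : 0 < A₁ := by linarith
  set A : ℝ := A₁ * A₂ * A₃ with hAdef
  have hA1 : 1 ≤ A := by
    have h12 : 1 ≤ A₁ * A₂ := one_le_mul_of_one_le_of_one_le hA₁1 hA₂1
    exact one_le_mul_of_one_le_of_one_le h12 hA₃1
  have hA0 : 0 < A := by linarith
  have hN1r : (1 : ℝ) ≤ N := hA1.trans hNA
  have hN0r : (0 : ℝ) < N := by linarith
  have hN1 : 1 ≤ N := by exact_mod_cast hN1r
  set κ : ℝ := 1 / 4 - δ with hκdef
  have hκ0 : 0 ≤ κ := by rw [hκdef]; linarith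
  set B : ℝ := 864 * ℓ ^ 2 / δ ^ 2 * A ^ (1 / 4 : ℝ) with hBdef
  have hB0 : 0 ≤ B := by positivity
  -- the remainder and its bounds
  have hRre : ∀ t : ℝ, R t = (∑ n ∈ Ioc 0 ⌊t⌋₊, coeff χ₁ χ₂ n - L₁ * L₂ * L₃ * t).re := by
    intro t
    rw [hR, ← haC, Complex.sub_re, Complex.re_sum, show Finset.Icc 1 ⌊t⌋₊ = Finset.Ioc 0 ⌊t⌋₊ by
      ext k; simp only [Finset.mem_Icc, Finset.mem_Ioc]; omega]
    congr 1
    · exact sum_congr rfl fun n _ => by rw [← hfC n, Complex.ofReal_re]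
    · rw [← Complex.ofReal_mul, Complex.ofReal_re]
  have hB : ∀ t : ℝ, A ≤ t → |R t| ≤ B * t ^ (1 - κ) := by
    intro t ht
    have ht1 : 1 ≤ t := hA1.trans ht
    have ht0 : 0 < t := by linarith only [ht1]
    have h := norm_summatory_coeff_sub_le χ₁ χ₂ hχ₁ hq₁ hχ₂ hψ hA₁1 hA₂1 hA₃1 hℓ1 hA₁ hA₂ hA₃
      hL₁ hL₂ ht
    have hlog := one_add_log_sq_le' ht1 hδ0 (by linarith only [hδ])
    rw [hRre]
    refine (abs_re_le_norm _).trans (h.trans ?_)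
    have hpow : t ^ (3 / 4 : ℝ) * t ^ δ = t ^ (1 - κ) := by
      rw [← Real.rpow_add ht0, hκdef]; ring_nf
    calc 54 * ℓ ^ 2 * A ^ (1 / 4 : ℝ) * t ^ (3 / 4 : ℝ) * (1 + Real.log t) ^ 2
        ≤ 54 * ℓ ^ 2 * A ^ (1 / 4 : ℝ) * t ^ (3 / 4 : ℝ) * (16 / δ ^ 2 * t ^ δ) :=
          mul_le_mul_of_nonneg_left hlog (by positivity)
      _ = B * (t ^ (3 / 4 : ℝ) * t ^ δ) := by rw [hBdef]; ring
      _ = B * t ^ (1 - κ) := by rw [hpow]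
  set K₀ : ℝ := 2 * a * A + B * A ^ (1 - κ) with hK₀def
  have hK₀0 : 0 ≤ K₀ := by positivity
  have hRb : ∀ t : ℝ, 1 ≤ t → |R t| ≤ (B + K₀) * t ^ (1 - κ) := by
    intro t ht1
    have ht0 : 0 < t := by linarith only [ht1]
    have htp : 1 ≤ t ^ (1 - κ) := Real.one_le_rpow ht1 (by rw [hκdef]; linarith only [hδ0])
    have hBK : B ≤ B + K₀ := by linarith only [hK₀0]
    rcases le_or_gt A t with hAt | hAt
    · calc |R t| ≤ B * t ^ (1 - κ) := hB t hAt
        _ ≤ (B + K₀) * t ^ (1 - κ) := by gcongr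
    · have hHt : ∑ k ∈ Icc 1 ⌊t⌋₊, f k ≤ ∑ k ∈ Icc 1 ⌊A⌋₊, f k :=
        sum_le_sum_of_subset_of_nonneg (Finset.Icc_subset_Icc le_rfl (Nat.floor_mono hAt.le))
          (fun k _ _ => hf k)
      have hHA : ∑ k ∈ Icc 1 ⌊A⌋₊, f k ≤ a * A + B * A ^ (1 - κ) := by
        have h1 := hB A le_rfl
        rw [hR] at h1
        have := (abs_le.mp h1).2
        linarith only [this]
      have hH0 : 0 ≤ ∑ k ∈ Icc 1 ⌊t⌋₊, f k := sum_nonneg fun k _ => hf k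
      have hat : a * t ≤ a * A := mul_le_mul_of_nonneg_left hAt.le ha.le
      have hat0 : 0 ≤ a * t := by positivity
      have hBA : 0 ≤ B * A ^ (1 - κ) := by positivity
      have hRt : |R t| ≤ K₀ := by
        rw [hR, abs_le, hK₀def]
        constructor
        · linarith only [hH0, hat, hBA, hat0]
        · linarith only [hHt, hHA, hat0, hat]
      have hKB : K₀ ≤ B + K₀ := by linarith only [hB0]
      calc |R t| ≤ K₀ := hRt
        _ ≤ K₀ * t ^ (1 - κ) := le_mul_of_one_le_right hK₀0 htp
        _ ≤ (B + K₀) * t ^ (1 - κ) := by gcongr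
  -- the continued function
  obtain ⟨G, hG⟩ : ∃ G : ℂ → ℂ, ∀ s, G s = riemannZeta₁ s *
      (χ₁.LFunction s * χ₂.LFunction s * (prodChar χ₁ χ₂).LFunction s) := ⟨_, fun _ => rfl⟩
  have hGfun : G = fun s => riemannZeta₁ s *
      (χ₁.LFunction s * χ₂.LFunction s * (prodChar χ₁ χ₂).LFunction s) := funext hG
  have hdiffL : Differentiable ℂ (fun s => χ₁.LFunction s * χ₂.LFunction s *
      (prodChar χ₁ χ₂).LFunction s) :=
    ((DirichletCharacter.differentiable_LFunction hχ₁).mul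
      (DirichletCharacter.differentiable_LFunction hχ₂)).mul
      (DirichletCharacter.differentiable_LFunction hψ)
  have hGd : DifferentiableOn ℂ G {s : ℂ | 1 - κ < s.re} := by
    rw [hGfun]
    exact (differentiable_riemannZeta₁.mul hdiffL).differentiableOn
  have hGL : ∀ s : ℂ, 1 < s.re → G s = (s - 1) * LSeries (fun n => (f n : ℂ)) s := by
    intro s hs
    have hs1 : s ≠ 1 := by intro h; rw [h] at hs; simp at hs
    have hLS : LSeries (fun n => (f n : ℂ)) s = LSeries (fun n => coeff χ₁ χ₂ n) s :=
      LSeries_congr (fun {n} _ => hfC n) s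
    rw [hG, hLS, LSeries_coeff_eq χ₁ χ₂ hs, riemannZeta_eq_inv_sub_mul hs1]
    field_simp
  -- the real point `σ = 1 − τ`
  set σ : ℝ := 1 - τ with hσdef
  have hσκ : 1 - κ < σ := by rw [hσdef]; linarith only [hτ]
  have hσ1 : σ < 1 := by rw [hσdef]; linarith only [hτ0]
  have hσκ' : 1 - κ < ((σ : ℂ)).re := by simpa using hσκ
  have hσ1' : (σ : ℂ) ≠ 1 := by
    intro h; have := congrArg Complex.re h; simp at this; linarith only [this, hσ1]
  -- `F(σ) = 0`, hence `Φ(σ) = aσ/(σ−1) + σ I(σ) = 0`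
  have hF0 : riemannZeta σ * (χ₁.LFunction σ * χ₂.LFunction σ * (prodChar χ₁ χ₂).LFunction σ)
      = 0 := by
    rcases hz with h | h
    · rw [h]; simp
    · rw [h]; simp
  have hΦ0 : (a : ℂ) * σ / ((σ : ℂ) - 1) + σ * I σ = 0 := by
    have hs1' : (σ : ℂ) - 1 ≠ 0 := sub_ne_zero.mpr hσ1'
    have hGs := continuation_eq hf hR hRb hκ0 hI hGd hGL hσκ'
    rw [hG] at hGs
    have : riemannZeta σ * (χ₁.LFunction σ * χ₂.LFunction σ * (prodChar χ₁ χ₂).LFunction σ) =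
        a * σ / ((σ : ℂ) - 1) + σ * I σ := by
      rw [riemannZeta_eq_inv_sub_mul hσ1', mul_assoc, hGs]
      field_simp
    rw [← this, hF0]
  have hΦre : a * σ / (σ - 1) + σ * ∫ t in Ioi (1 : ℝ), R t * t ^ (-(σ + 1)) = 0 := by
    have h := congrArg Complex.re hΦ0
    rw [remainderIntegral_ofReal hI σ] at h
    have e1 : ((a : ℂ) * σ / ((σ : ℂ) - 1)) = (((a * σ / (σ - 1) : ℝ)) : ℂ) := by push_cast; ring
    rw [e1, ← Complex.ofReal_mul, ← Complex.ofReal_add, Complex.ofReal_re, Complex.zero_re] at h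
    exact h
  -- the identity and the tail bounds
  have hid := sum_mul_rpow_neg_eq_continuation hf0 hR hRb hI hσκ hσ1 hN1
  have hα : 0 < σ + κ - 1 := by linarith only [hσκ]
  have hBN : ∀ t : ℝ, (N : ℝ) ≤ t → |R t| ≤ B * t ^ (1 - κ) := fun t ht => hB t (hNA.trans ht)
  obtain ⟨hT1, hT2⟩ := abs_tail_le' hN1 hBN hR hα
  have hακ : σ + κ - 1 = κ - τ := by rw [hσdef]; ring
  have h1σ : 1 - σ = τ := by rw [hσdef]; ring
  have hsum : ∑ k ∈ Icc 1 N, (coeff χ₁ χ₂ k).re * (k : ℝ) ^ (-(1 - τ)) =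
      ∑ k ∈ Icc 1 N, f k * (k : ℝ) ^ (-σ) := by
    refine sum_congr rfl fun k _ => ?_; rw [hfdef]
  rw [hsum, hid, hΦre, zero_add, h1σ, ← hadef]
  have hσ0 : 0 ≤ σ := by rw [hσdef]; linarith only [hτ, hκdef, hδ0]
  have hσle : σ ≤ 1 := hσ1.le
  have hX0 : 0 ≤ B * (N : ℝ) ^ (-(σ + κ - 1)) := by positivity
  set J : ℝ := ∫ t in Ioi (N : ℝ), R t * t ^ (-(σ + 1)) with hJ
  rw [show a * (N : ℝ) ^ τ / τ + R N * (N : ℝ) ^ (-σ) - σ * J - a * (N : ℝ) ^ τ / τ =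
      R N * (N : ℝ) ^ (-σ) - σ * J by ring]
  calc |R N * (N : ℝ) ^ (-σ) - σ * J|
      ≤ |R N * (N : ℝ) ^ (-σ)| + |σ * J| := abs_sub _ _
    _ ≤ B * (N : ℝ) ^ (-(σ + κ - 1)) + σ * (B * (N : ℝ) ^ (-(σ + κ - 1)) / (σ + κ - 1)) := by
        refine add_le_add hT1 ?_
        rw [abs_mul, abs_of_nonneg hσ0]
        exact mul_le_mul_of_nonneg_left hT2 hσ0
    _ ≤ B * (N : ℝ) ^ (-(σ + κ - 1)) + 1 * (B * (N : ℝ) ^ (-(σ + κ - 1)) / (σ + κ - 1)) := by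
        gcongr
    _ = B * (N : ℝ) ^ (-(κ - τ)) * (1 + 1 / (κ - τ)) := by
        rw [hακ]; ring

end LandauRealPoint

/-! ## Part C. The proof of Theorem 6 for a pair `χ₁` (minimal modulus, Siegel zero `1 − γ`) and
`χ₂ ≠ χ₁` (zero `1 − δ`), `D₁ ≤ D₂`: (4.6)–(4.9), pp. 96–97 -/

section TatuzawaCore

open DirichletAbel RealChar SiegelCoefficients
open scoped ComplexOrder

/-- `u x^{−u} ≤ 1/(e log x)` for `u > 0`, `x > 1` ("`τx^{−τ}` is maximal for `τ = 1/log x`",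
p. 96). [cite: Pintz1977ElementaryVIII, proof of Theorem 6 p. 96] -/
theorem mul_rpow_neg_le_inv_log {u x : ℝ} (hu : 0 < u) (hx : 1 < x) :
    u * x ^ (-u) ≤ 1 / (Real.exp 1 * Real.log x) := by
  have hlog : 0 < Real.log x := Real.log_pos hx
  have hx0 : 0 < x := by linarith
  set t := u * Real.log x with ht
  have hxu : x ^ (-u) = Real.exp (-t) := by
    rw [Real.rpow_def_of_pos hx0, ht]; ring_nf
  have h1 : t ≤ Real.exp (t - 1) := by have := Real.add_one_le_exp (t - 1); linarith
  have h2 : t * Real.exp (-t) ≤ Real.exp (-1) := by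
    have := mul_le_mul_of_nonneg_right h1 (Real.exp_pos (-t)).le
    rwa [← Real.exp_add, show t - 1 + -t = -1 by ring] at this
  have hu' : u = t / Real.log x := by rw [ht]; field_simp
  rw [hxu, hu']
  calc t / Real.log x * Real.exp (-t) = (t * Real.exp (-t)) / Real.log x := by ring
    _ ≤ Real.exp (-1) / Real.log x := div_le_div_of_nonneg_right h2 hlog.le
    _ = 1 / (Real.exp 1 * Real.log x) := by rw [Real.exp_neg, inv_eq_one_div, div_div]

/-- `u ↦ u x^{−u}` is non-increasing for `u ≥ 1/log x` (`x > 1`) ("and is monotonically decreasing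
for `τ > 1/log x`", p. 96). [cite: Pintz1977ElementaryVIII, proof of Theorem 6 p. 96] -/
theorem mul_rpow_neg_le_mul_rpow_neg {u v x : ℝ} (hx : 1 < x) (hu : 1 / Real.log x ≤ u)
    (huv : u ≤ v) : v * x ^ (-v) ≤ u * x ^ (-u) := by
  have hlog : 0 < Real.log x := Real.log_pos hx
  have hu0 : 0 < u := lt_of_lt_of_le (by positivity) hu
  have hx0 : 0 < x := by linarith
  have hL : 1 ≤ u * Real.log x := by rwa [div_le_iff₀ hlog] at hu
  have h1 : v ≤ u * x ^ (v - u) := by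
    have he : 1 + (v - u) * Real.log x ≤ x ^ (v - u) := by
      rw [Real.rpow_def_of_pos hx0]
      have := Real.add_one_le_exp (Real.log x * (v - u))
      linarith [mul_comm (Real.log x) (v - u)]
    have h0 : v ≤ u * (1 + (v - u) * Real.log x) := by
      have : (v - u) * 1 ≤ (v - u) * (u * Real.log x) :=
        mul_le_mul_of_nonneg_left hL (by linarith)
      nlinarith [this]
    exact h0.trans (mul_le_mul_of_nonneg_left he hu0.le)
  have hxv : 0 < x ^ (-v) := Real.rpow_pos_of_pos hx0 _
  calc v * x ^ (-v) ≤ u * x ^ (v - u) * x ^ (-v) := mul_le_mul_of_nonneg_right h1 hxv.le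
    _ = u * x ^ (-u) := by rw [mul_assoc, ← Real.rpow_add hx0]; ring_nf

variable {D₁ D₂ : ℕ} [NeZero D₁] [NeZero D₂] (χ₁ : DirichletCharacter ℂ D₁)
  (χ₂ : DirichletCharacter ℂ D₂)

/-- **The core of the proof of Theorem 6** (pp. 96–97, (4.6)–(4.9)). Let `χ₁ mod D₁`, `χ₂ mod D₂`
(`D₁ ≤ D₂`) be quadratic non-principal with `χ₁χ₂` non-principal, partial-sum bounds `A₁, A₂, A₃`,
`|L(1,χ_i)| ≤ ℓ`; let `D = D₁D₂ ≥ e⁷`, `x = D³ ≥ A₁A₂A₃` with the Lemma-2 error at `x` at most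
`1/25`; let `0 < ε ≤ 1/5`, `L(1 − γ, χ₁) = 0` with `0 < γ ≤ ε/(7D₁^ε)` (a Siegel zero), `L(1 − δ, χ₂) = 0`
with `δ > 0`, and suppose Theorem 5 in the form `max(γ, δ) > 1/(3 log D)` ((4.6)). Then
`δ > ε/(7 D₂^ε)`: if `δ > 1/(3 log D)` this is (4.7) (`τ D^{−τ} ≤ 1/(e log D)`); otherwise
`γ > 1/(3 log D) = 1/log x`, and comparing Lemma 2 at the two real zeros of `F(s, χ₁, χ₂)` ((4.1)–(4.3):
`∑ f(m)m^{−(1−γ)} ≥ ∑ f(m) m^{−(1−δ)}`) gives `δ ≥ (12/13) γ x^{−γ} ≥ (12/13)(ε/6) x^{−ε/6} ≥ (2/13) ε D₂^{−ε}`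
((4.9), `x^{1/6} = D^{1/2} ≤ D₂`). [cite: Pintz1977ElementaryVIII, proof of Theorem 6, (4.6)–(4.9) pp. 96–97] -/
theorem tatuzawa_core (hχ₁ : χ₁ ≠ 1) (hq₁ : χ₁ ^ 2 = 1) (hχ₂ : χ₂ ≠ 1) (hq₂ : χ₂ ^ 2 = 1)
    (hψ : prodChar χ₁ χ₂ ≠ 1) {A₁ A₂ A₃ ℓ : ℝ} (hA₁1 : 1 ≤ A₁) (hA₂1 : 1 ≤ A₂) (hA₃1 : 1 ≤ A₃)
    (hℓ1 : 1 ≤ ℓ) (hA₁ : ∀ n, ‖partialSum χ₁ n‖ ≤ A₁) (hA₂ : ∀ n, ‖partialSum χ₂ n‖ ≤ A₂)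
    (hA₃ : ∀ n, ‖partialSum (prodChar χ₁ χ₂) n‖ ≤ A₃) (hL₁ : ‖χ₁.LFunction 1‖ ≤ ℓ)
    (hL₂ : ‖χ₂.LFunction 1‖ ≤ ℓ) (hD : D₁ ≤ D₂) (hQ7 : Real.exp 7 ≤ ((D₁ * D₂ : ℕ) : ℝ))
    (hNA : A₁ * A₂ * A₃ ≤ (((D₁ * D₂) ^ 3 : ℕ) : ℝ))
    (hE : 864 * ℓ ^ 2 / (1 / 80) ^ 2 * (A₁ * A₂ * A₃) ^ (1 / 4 : ℝ) *
      (((D₁ * D₂) ^ 3 : ℕ) : ℝ) ^ (-(3 / 16 : ℝ)) * (19 / 3) ≤ 1 / 25)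
    {ε : ℝ} (hε0 : 0 < ε) (hε : ε ≤ 1 / 5) {γ δ : ℝ} (hγ0 : 0 < γ)
    (hγ : γ ≤ ε / (7 * (D₁ : ℝ) ^ ε)) (hδ0 : 0 < δ)
    (hzγ : χ₁.LFunction ((1 - γ : ℝ) : ℂ) = 0) (hzδ : χ₂.LFunction ((1 - δ : ℝ) : ℂ) = 0)
    (h5 : 1 / (3 * Real.log ((D₁ * D₂ : ℕ) : ℝ)) < max γ δ) :
    ε / (7 * (D₂ : ℝ) ^ ε) < δ := by
  set Q : ℝ := ((D₁ * D₂ : ℕ) : ℝ) with hQdef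
  have hD₁1 : (1 : ℝ) ≤ D₁ := by exact_mod_cast NeZero.one_le
  have hD₂1 : (1 : ℝ) ≤ D₂ := by exact_mod_cast NeZero.one_le
  have hD₂0 : (0 : ℝ) < D₂ := by linarith
  have hQprod : Q = (D₁ : ℝ) * D₂ := by rw [hQdef]; push_cast; ring
  have he7 : (7 : ℝ) ≤ Real.exp 7 := by have := Real.add_one_le_exp (7 : ℝ); linarith
  have hQ1 : 1 < Q := by linarith
  have hQ0 : 0 < Q := by linarith
  have hlogQ7 : 7 ≤ Real.log Q := by
    rw [← Real.log_exp 7]; exact Real.log_le_log (Real.exp_pos 7) hQ7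
  have hlogQ : 0 < Real.log Q := by linarith
  -- `D₂^ε ≥ Q^{ε/2}` (`D₂ ≥ D₁`), `D₁^ε ≥ 1`
  have hQD₂ : Q ≤ (D₂ : ℝ) ^ 2 := by
    rw [hQprod, sq]; exact mul_le_mul_of_nonneg_right (by exact_mod_cast hD) hD₂0.le
  have hD₂ε : Q ^ (ε / 2) ≤ (D₂ : ℝ) ^ ε := by
    calc Q ^ (ε / 2) ≤ ((D₂ : ℝ) ^ 2) ^ (ε / 2) := Real.rpow_le_rpow hQ0.le hQD₂ (by linarith)
      _ = (D₂ : ℝ) ^ ε := by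
          rw [← Real.rpow_natCast, ← Real.rpow_mul hD₂0.le]; congr 1; push_cast; ring
  have hQε0 : 0 < Q ^ (ε / 2) := Real.rpow_pos_of_pos hQ0 _
  have hD₂ε0 : 0 < (D₂ : ℝ) ^ ε := Real.rpow_pos_of_pos hD₂0 _
  have hD₁ε1 : 1 ≤ (D₁ : ℝ) ^ ε := Real.one_le_rpow hD₁1 hε0.le
  -- the target in the form `(1/7) ε D₂^{−ε}` and the bound `ε Q^{−ε/2} ≤ 2/(e log Q)`
  have htarget : ε / (7 * (D₂ : ℝ) ^ ε) ≤ ε / (7 * Q ^ (ε / 2)) := by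
    gcongr
  have hεQ : ε / (7 * Q ^ (ε / 2)) ≤ 2 / (7 * (Real.exp 1 * Real.log Q)) := by
    have h := mul_rpow_neg_le_inv_log (half_pos hε0) hQ1
    rw [Real.rpow_neg hQ0.le] at h
    -- `ε/2 · (Q^{ε/2})⁻¹ ≤ 1/(e log Q)`
    have e1 : ε / (7 * Q ^ (ε / 2)) = 2 / 7 * (ε / 2 * (Q ^ (ε / 2))⁻¹) := by
      field_simp
    rw [e1, show 2 / (7 * (Real.exp 1 * Real.log Q)) = 2 / 7 * (1 / (Real.exp 1 * Real.log Q)) by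
      field_simp]
    exact mul_le_mul_of_nonneg_left h (by norm_num)
  have hexp1 : (2.7 : ℝ) < Real.exp 1 := lt_trans (by norm_num) Real.exp_one_gt_d9
  have h47 : 2 / (7 * (Real.exp 1 * Real.log Q)) < 1 / (3 * Real.log Q) := by
    rw [div_lt_div_iff₀ (by positivity) (by positivity)]
    nlinarith [hlogQ, hexp1]
  -- case (4.7): `δ > 1/(3 log Q)`
  by_cases hcase : 1 / (3 * Real.log Q) < δ
  · linarith [htarget, hεQ, h47]
  -- case (4.8)–(4.9): `δ ≤ 1/(3 log Q) < γ`
  push Not at hcase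
  have hγbig : 1 / (3 * Real.log Q) < γ := by
    rcases lt_max_iff.mp h5 with h | h
    · exact h
    · exact absurd h (not_lt.mpr hcase)
  have hγε : γ ≤ ε / 7 := by
    calc γ ≤ ε / (7 * (D₁ : ℝ) ^ ε) := hγ
      _ ≤ ε / (7 * 1) := by gcongr
      _ = ε / 7 := by ring
  have hγ20 : γ ≤ 1 / 20 := by linarith
  have hδγ : δ ≤ γ := le_trans hcase hγbig.le
  have hδ20 : δ ≤ 1 / 20 := by
    have : 1 / (3 * Real.log Q) ≤ 1 / 20 := by
      rw [div_le_div_iff₀ (by positivity) (by norm_num)]; linarith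
    linarith
  -- the window `x = N = Q³`
  set N : ℕ := (D₁ * D₂) ^ 3 with hNdef
  have hNQ : (N : ℝ) = Q ^ 3 := by rw [hNdef, hQdef]; push_cast; ring
  have hN1 : (1 : ℝ) < N := by rw [hNQ]; exact one_lt_pow₀ hQ1 (by norm_num)
  have hN0 : (0 : ℝ) < N := by linarith
  have hlogN : Real.log N = 3 * Real.log Q := by rw [hNQ, Real.log_pow]; norm_num
  -- Lemma 2 at the two zeros, with `δ' = 1/80`, `κ = 19/80`
  have hcoef : ∀ {τ : ℝ}, 0 < τ → τ ≤ 1 / 20 →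
      864 * ℓ ^ 2 / (1 / 80) ^ 2 * (A₁ * A₂ * A₃) ^ (1 / 4 : ℝ) * (N : ℝ) ^ (-(1 / 4 - 1 / 80 - τ)) *
        (1 + 1 / (1 / 4 - 1 / 80 - τ)) ≤ 1 / 25 := by
    intro τ hτ0 hτ
    have h1 : (N : ℝ) ^ (-(1 / 4 - 1 / 80 - τ)) ≤ (N : ℝ) ^ (-(3 / 16 : ℝ)) :=
      Real.rpow_le_rpow_of_exponent_le hN1.le (by linarith)
    have h2 : 1 + 1 / (1 / 4 - 1 / 80 - τ) ≤ 19 / 3 := by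
      have hpos : (3 : ℝ) / 16 ≤ 1 / 4 - 1 / 80 - τ := by linarith
      have : 1 / (1 / 4 - 1 / 80 - τ) ≤ 16 / 3 := by
        rw [div_le_div_iff₀ (by linarith) (by norm_num)]; linarith
      linarith
    have h0 : 0 ≤ 864 * ℓ ^ 2 / (1 / 80) ^ 2 * (A₁ * A₂ * A₃) ^ (1 / 4 : ℝ) := by positivity
    have h3 : 0 ≤ 1 + 1 / (1 / 4 - 1 / 80 - τ) := by
      have : 0 < 1 / 4 - 1 / 80 - τ := by linarith
      positivity
    calc _ ≤ 864 * ℓ ^ 2 / (1 / 80) ^ 2 * (A₁ * A₂ * A₃) ^ (1 / 4 : ℝ) * (N : ℝ) ^ (-(3 / 16 : ℝ)) *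
          (19 / 3) := by gcongr
      _ ≤ 1 / 25 := hE
  have hNA' : A₁ * A₂ * A₃ ≤ (N : ℝ) := by rw [hNdef]; exact_mod_cast hNA
  have hSγ := landau_sum_rpow_of_zero χ₁ χ₂ hχ₁ hq₁ hχ₂ hq₂ hψ hA₁1 hA₂1 hA₃1 hℓ1 hA₁ hA₂ hA₃ hL₁
    hL₂ (by norm_num : (0 : ℝ) < 1 / 80) (by norm_num) hNA' hγ0 (by linarith) (Or.inl hzγ)
  have hSδ := landau_sum_rpow_of_zero χ₁ χ₂ hχ₁ hq₁ hχ₂ hq₂ hψ hA₁1 hA₂1 hA₃1 hℓ1 hA₁ hA₂ hA₃ hL₁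
    hL₂ (by norm_num : (0 : ℝ) < 1 / 80) (by norm_num) hNA' hδ0 (by linarith) (Or.inr hzδ)
  have hEγ := hcoef hγ0 hγ20
  have hEδ := hcoef hδ0 hδ20
  set a : ℝ := (χ₁.LFunction 1).re * (χ₂.LFunction 1).re * ((prodChar χ₁ χ₂).LFunction 1).re
    with hadef
  have hψq : prodChar χ₁ χ₂ ^ 2 = 1 := prodChar_sq_eq_one χ₁ χ₂ hq₁ hq₂
  have ha : 0 < a := by
    rw [hadef]
    exact mul_pos (mul_pos (Siegel.LFunction_one_re_pos χ₁ hχ₁ hq₁)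
      (Siegel.LFunction_one_re_pos χ₂ hχ₂ hq₂)) (Siegel.LFunction_one_re_pos _ hψ hψq)
  set Sγ : ℝ := ∑ k ∈ Icc 1 N, (coeff χ₁ χ₂ k).re * (k : ℝ) ^ (-(1 - γ)) with hSγdef
  set Sδ : ℝ := ∑ k ∈ Icc 1 N, (coeff χ₁ χ₂ k).re * (k : ℝ) ^ (-(1 - δ)) with hSδdef
  have habsγ : |Sγ - a * (N : ℝ) ^ γ / γ| ≤ 1 / 25 := hSγ.trans hEγ
  have habsδ : |Sδ - a * (N : ℝ) ^ δ / δ| ≤ 1 / 25 := hSδ.trans hEδ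
  -- `S(δ) ≤ S(γ)` (termwise, `r ≥ 0`, `δ ≤ γ`) and `S(γ) ≥ f(1) = 1`
  have hr0 : ∀ k, 0 ≤ (coeff χ₁ χ₂ k).re := fun k =>
    (Complex.nonneg_iff.mp (coeff_nonneg χ₁ χ₂ hq₁ hq₂ k)).1
  have hSle : Sδ ≤ Sγ := by
    refine sum_le_sum fun k hk => ?_
    have hk1 : (1 : ℝ) ≤ k := by exact_mod_cast (Finset.mem_Icc.mp hk).1
    exact mul_le_mul_of_nonneg_left (Real.rpow_le_rpow_of_exponent_le hk1
      (by linarith only [hδγ])) (hr0 k)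
  have hS1 : 1 ≤ Sγ := by
    have hN1' : 1 ≤ N := by exact_mod_cast hN1.le
    have h1 : (1 : ℕ) ∈ Finset.Icc 1 N := Finset.mem_Icc.mpr ⟨le_rfl, hN1'⟩
    have := Finset.single_le_sum (f := fun k => (coeff χ₁ χ₂ k).re * (k : ℝ) ^ (-(1 - γ)))
      (fun k _ => mul_nonneg (hr0 k) (Real.rpow_nonneg (Nat.cast_nonneg k) _)) h1
    simp only [Nat.cast_one, Real.one_rpow, mul_one, coeff_apply_one, Complex.one_re] at this
    exact this
  -- `a N^δ/δ ≤ (13/12) a N^γ/γ`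
  set P : ℝ := a * (N : ℝ) ^ γ / γ with hPdef
  set Pδ : ℝ := a * (N : ℝ) ^ δ / δ with hPδdef
  have hP1 : 24 / 25 ≤ P := by
    have := (abs_le.mp habsγ).2; linarith only [this, hS1]
  have hPδle : Pδ ≤ 13 / 12 * P := by
    have h1 := (abs_le.mp habsδ).1
    have h2 := (abs_le.mp habsγ).2
    linarith only [h1, h2, hSle, hP1]
  -- `δ ≥ (12/13) γ N^{−γ}`
  have hNγ : 0 < (N : ℝ) ^ γ := Real.rpow_pos_of_pos hN0 _
  have hNδ1 : 1 ≤ (N : ℝ) ^ δ := Real.one_le_rpow hN1.le hδ0.le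
  have hδlow : 12 / 13 * (γ * (N : ℝ) ^ (-γ)) ≤ δ := by
    -- from `a N^δ/δ ≤ (13/12) a N^γ/γ`: `a/δ ≤ a N^δ/δ`, so `a/δ ≤ (13/12) a N^γ/γ`
    have h1 : a / δ ≤ Pδ := by
      rw [hPδdef, div_le_div_iff_of_pos_right hδ0]; exact le_mul_of_one_le_right ha.le hNδ1
    have h2 : a / δ ≤ 13 / 12 * (a * (N : ℝ) ^ γ / γ) := h1.trans hPδle
    -- divide by `a > 0` and rearrange
    rw [Real.rpow_neg hN0.le]
    rw [div_le_iff₀ hδ0] at h2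
    have h3 : a * (12 / 13 * (γ * ((N : ℝ) ^ γ)⁻¹)) * ((N : ℝ) ^ γ * 13 / 12 / γ) = a := by
      field_simp
    have h4 : 0 < (N : ℝ) ^ γ * 13 / 12 / γ := by positivity
    -- `a ≤ (13/12)(a N^γ/γ) δ` ⇒ `12 γ /(13 N^γ) ≤ δ`
    by_contra hcon
    push Not at hcon
    have : 13 / 12 * (a * (N : ℝ) ^ γ / γ) * δ < 13 / 12 * (a * (N : ℝ) ^ γ / γ) *
        (12 / 13 * (γ * ((N : ℝ) ^ γ)⁻¹)) := mul_lt_mul_of_pos_left hcon (by positivity)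
    have e : 13 / 12 * (a * (N : ℝ) ^ γ / γ) * (12 / 13 * (γ * ((N : ℝ) ^ γ)⁻¹)) = a := by
      field_simp
    linarith only [this, e, h2]
  -- `γ N^{−γ} ≥ (ε/6) N^{−ε/6}` and `N^{ε/6} = Q^{ε/2} ≤ D₂^ε`
  have hmono : ε / 6 * (N : ℝ) ^ (-(ε / 6)) ≤ γ * (N : ℝ) ^ (-γ) := by
    refine mul_rpow_neg_le_mul_rpow_neg hN1 ?_ (by linarith only [hγε, hε0])
    rw [hlogN]; exact hγbig.le
  have hNε : (N : ℝ) ^ (-(ε / 6)) ≥ ((D₂ : ℝ) ^ ε)⁻¹ := by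
    rw [Real.rpow_neg hN0.le, ge_iff_le, inv_le_inv₀ hD₂ε0 (Real.rpow_pos_of_pos hN0 _)]
    calc (N : ℝ) ^ (ε / 6) = Q ^ (ε / 2) := by
          rw [hNQ, ← Real.rpow_natCast, ← Real.rpow_mul hQ0.le]; norm_num; ring_nf
      _ ≤ (D₂ : ℝ) ^ ε := hD₂ε
  have hfin : ε / (7 * (D₂ : ℝ) ^ ε) < 12 / 13 * (ε / 6 * ((D₂ : ℝ) ^ ε)⁻¹) := by
    rw [show ε / (7 * (D₂ : ℝ) ^ ε) = 1 / 7 * (ε * ((D₂ : ℝ) ^ ε)⁻¹) by field_simp,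
      show 12 / 13 * (ε / 6 * ((D₂ : ℝ) ^ ε)⁻¹) = 2 / 13 * (ε * ((D₂ : ℝ) ^ ε)⁻¹) by ring]
    exact mul_lt_mul_of_pos_right (by norm_num) (by positivity)
  calc ε / (7 * (D₂ : ℝ) ^ ε) < 12 / 13 * (ε / 6 * ((D₂ : ℝ) ^ ε)⁻¹) := hfin
    _ ≤ 12 / 13 * (ε / 6 * (N : ℝ) ^ (-(ε / 6))) := by gcongr
    _ ≤ 12 / 13 * (γ * (N : ℝ) ^ (-γ)) := by gcongr
    _ ≤ δ := hδlow

end TatuzawaCore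

/-! ## Part D. The absolute threshold `D₀`: the window conditions at `x = D³` for all large `D` -/

section TatuzawaAssembly

open DirichletAbel RealChar SiegelCoefficients

/-- `(1 + log x)/x^u → 0` (`u > 0`). [folklore] -/
private theorem tendsto_one_add_log_div_rpow'' {u : ℝ} (hu : 0 < u) :
    Tendsto (fun x : ℝ => (1 + Real.log x) / x ^ u) atTop (𝓝 0) := by
  have h1 : Tendsto (fun x : ℝ => x ^ (-u)) atTop (𝓝 0) := tendsto_rpow_neg_atTop hu
  have h2 := (isLittleO_log_rpow_atTop hu).tendsto_div_nhds_zero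
  have h := h1.add h2
  rw [add_zero] at h
  refine h.congr' ?_
  filter_upwards [eventually_gt_atTop 0] with x hx
  rw [Real.rpow_neg hx.le, add_div, inv_eq_one_div]

/-- `((1 + log x)/x^u)^n = (1 + log x)^n · x^{−nu}` for `x > 0`. [folklore] -/
private theorem one_add_log_div_rpow_pow' {x u : ℝ} (hx : 0 < x) (n : ℕ) :
    ((1 + Real.log x) / x ^ u) ^ n = (1 + Real.log x) ^ n * x ^ (-(n * u)) := by
  rw [div_pow, ← Real.rpow_natCast (x ^ u), ← Real.rpow_mul hx.le, Real.rpow_neg hx.le,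
    div_eq_mul_inv, mul_comm u]

/-- **The window conditions at `x = D³` for all large `D`** (divisor bound `τ(D) ≤ C D^{1/80}`):
`D ≥ e⁷`, `A = τ(D) D (1 + log D)³ ≤ D³`, and the Lemma-2 error
`(864·80²)(1 + log D)² A^{1/4} (D³)^{−3/16} (19/3) ≤ 1/25`. [folklore] -/
private theorem exists_tatuzawa_conditions_nat :
    ∃ Q₀ : ℕ, ∀ Q : ℕ, Q₀ ≤ Q →
      Real.exp 7 ≤ (Q : ℝ) ∧
      ((ArithmeticFunction.sigma 0 Q : ℕ) : ℝ) * Q * (1 + Real.log Q) ^ 3 ≤ ((Q ^ 3 : ℕ) : ℝ) ∧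
      864 * (1 + Real.log Q) ^ 2 / (1 / 80) ^ 2 *
          (((ArithmeticFunction.sigma 0 Q : ℕ) : ℝ) * Q * (1 + Real.log Q) ^ 3) ^ (1 / 4 : ℝ) *
        ((Q ^ 3 : ℕ) : ℝ) ^ (-(3 / 16 : ℝ)) * (19 / 3) ≤ 1 / 25 := by
  obtain ⟨C, hC1, hC⟩ :=
    Literature.NumberTheory.Sieve.exists_sigma_zero_le_mul_rpow (ε := 1 / 80) (by norm_num)
  have hC0 : 0 < C := by linarith
  set K : ℝ := 864 / (1 / 80) ^ 2 * C * (19 / 3) with hKdef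
  have hK0 : 0 < K := by positivity
  have h1 : ∀ᶠ x : ℝ in atTop, Real.exp 7 ≤ x := eventually_ge_atTop _
  have h2 : ∀ᶠ x : ℝ in atTop, ((1 + Real.log x) / x ^ ((159 / 80 : ℝ) / 3)) ^ 3 < 1 / C :=
    (tendsto_order.1 ((tendsto_one_add_log_div_rpow'' (u := (159 / 80 : ℝ) / 3)
      (by norm_num)).pow 3)).2 _ (by rw [zero_pow three_ne_zero]; positivity)
  have h3 : ∀ᶠ x : ℝ in atTop, ((1 + Real.log x) / x ^ ((99 / 320 : ℝ) / 3)) ^ 3 < 1 / 25 / K :=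
    (tendsto_order.1 ((tendsto_one_add_log_div_rpow'' (u := (99 / 320 : ℝ) / 3)
      (by norm_num)).pow 3)).2 _ (by rw [zero_pow three_ne_zero]; positivity)
  obtain ⟨x₀, hx₀⟩ := Filter.eventually_atTop.mp ((h1.and (h2.and h3)).and (eventually_ge_atTop 1))
  refine ⟨⌈x₀⌉₊, fun Q hQ => ?_⟩
  have hQx : x₀ ≤ (Q : ℝ) := (Nat.le_ceil x₀).trans (by exact_mod_cast hQ)
  obtain ⟨⟨hQ1, hQ2, hQ3⟩, hQone⟩ := hx₀ Q hQx
  have hQ0 : (0 : ℝ) < Q := by linarith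
  have hQne : (Q : ℕ) ≠ 0 := by exact_mod_cast hQ0.ne'
  have hlogQ : 0 ≤ Real.log Q := Real.log_nonneg hQone
  rw [one_add_log_div_rpow_pow' hQ0 3] at hQ2 hQ3
  set ℓ : ℝ := 1 + Real.log Q with hℓdef
  have hℓ1 : 1 ≤ ℓ := by linarith
  have hτ : ((ArithmeticFunction.sigma 0 Q : ℕ) : ℝ) ≤ C * (Q : ℝ) ^ (1 / 80 : ℝ) := hC Q
  set A : ℝ := ((ArithmeticFunction.sigma 0 Q : ℕ) : ℝ) * Q * ℓ ^ 3 with hAdef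
  have hτ1 : (1 : ℝ) ≤ ((ArithmeticFunction.sigma 0 Q : ℕ) : ℝ) := by
    have : 0 < ArithmeticFunction.sigma 0 Q := by
      rw [ArithmeticFunction.sigma_zero_apply]
      exact Finset.card_pos.mpr ⟨1, Nat.one_mem_divisors.mpr hQne⟩
    exact_mod_cast this
  have hA0 : 0 < A := by positivity
  have hAle : A ≤ C * (Q : ℝ) ^ (1 + 1 / 80 : ℝ) * ℓ ^ 3 := by
    rw [hAdef, show (1 : ℝ) + 1 / 80 = 1 / 80 + 1 by ring, Real.rpow_add_one hQ0.ne', ← mul_assoc]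
    exact mul_le_mul_of_nonneg_right (mul_le_mul_of_nonneg_right hτ hQ0.le) (by positivity)
  have hQcube : ((Q ^ 3 : ℕ) : ℝ) = (Q : ℝ) ^ (3 : ℝ) := by
    rw [show (3 : ℝ) = ((3 : ℕ) : ℝ) by norm_num, Real.rpow_natCast]; push_cast; ring
  refine ⟨hQ1, ?_, ?_⟩
  · -- (ii): `A ≤ Q³`
    have hpow : (Q : ℝ) ^ (3 : ℝ) = (Q : ℝ) ^ (1 + 1 / 80 : ℝ) * (Q : ℝ) ^ ((3 : ℕ) * ((159 / 80 : ℝ) / 3)) := by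
      rw [← Real.rpow_add hQ0]; norm_num
    have hQp : 0 < (Q : ℝ) ^ ((3 : ℕ) * ((159 / 80 : ℝ) / 3)) := Real.rpow_pos_of_pos hQ0 _
    have hid : (Q : ℝ) ^ (-((3 : ℕ) * ((159 / 80 : ℝ) / 3))) * (Q : ℝ) ^ ((3 : ℕ) * ((159 / 80 : ℝ) / 3))
        = 1 := by
      rw [← Real.rpow_add hQ0]; ring_nf; exact Real.rpow_zero _
    have hCℓ : C * ℓ ^ 3 ≤ (Q : ℝ) ^ ((3 : ℕ) * ((159 / 80 : ℝ) / 3)) := by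
      have h' := mul_lt_mul_of_pos_right hQ2 (mul_pos hC0 hQp)
      rw [show ℓ ^ 3 * (Q : ℝ) ^ (-((3 : ℕ) * ((159 / 80 : ℝ) / 3))) * (C * (Q : ℝ) ^
          ((3 : ℕ) * ((159 / 80 : ℝ) / 3))) = C * ℓ ^ 3 * ((Q : ℝ) ^ (-((3 : ℕ) *
          ((159 / 80 : ℝ) / 3))) * (Q : ℝ) ^ ((3 : ℕ) * ((159 / 80 : ℝ) / 3))) by ring, hid, mul_one,
        show 1 / C * (C * (Q : ℝ) ^ ((3 : ℕ) * ((159 / 80 : ℝ) / 3))) =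
          (Q : ℝ) ^ ((3 : ℕ) * ((159 / 80 : ℝ) / 3)) by field_simp] at h'
      exact h'.le
    have hQ1ν : 0 ≤ (Q : ℝ) ^ (1 + 1 / 80 : ℝ) := (Real.rpow_pos_of_pos hQ0 _).le
    calc A ≤ C * (Q : ℝ) ^ (1 + 1 / 80 : ℝ) * ℓ ^ 3 := hAle
      _ = (Q : ℝ) ^ (1 + 1 / 80 : ℝ) * (C * ℓ ^ 3) := by ring
      _ ≤ (Q : ℝ) ^ (1 + 1 / 80 : ℝ) * (Q : ℝ) ^ ((3 : ℕ) * ((159 / 80 : ℝ) / 3)) := by gcongr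
      _ = ((Q ^ 3 : ℕ) : ℝ) := by rw [hQcube, hpow]
  · -- (iii): the Lemma-2 error
    have hA4 : A ^ (1 / 4 : ℝ) ≤ C * (Q : ℝ) ^ ((1 + 1 / 80) / 4 : ℝ) * ℓ := by
      have hz0 : 0 ≤ C * (Q : ℝ) ^ ((1 + 1 / 80) / 4 : ℝ) * ℓ := by positivity
      have hz4 : (C * (Q : ℝ) ^ ((1 + 1 / 80) / 4 : ℝ) * ℓ) ^ 4 =
          C ^ 4 * (Q : ℝ) ^ (1 + 1 / 80 : ℝ) * ℓ ^ 4 := by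
        rw [mul_pow, mul_pow, ← Real.rpow_natCast ((Q : ℝ) ^ ((1 + 1 / 80) / 4 : ℝ)),
          ← Real.rpow_mul hQ0.le]
        norm_num
      have hAle' : A ≤ (C * (Q : ℝ) ^ ((1 + 1 / 80) / 4 : ℝ) * ℓ) ^ 4 := by
        rw [hz4]
        have hC4 : C ≤ C ^ 4 := le_self_pow₀ hC1 (by norm_num)
        have hℓ4 : ℓ ^ 3 ≤ ℓ ^ 4 := pow_le_pow_right₀ hℓ1 (by norm_num)
        have hQ1ν : 0 ≤ (Q : ℝ) ^ (1 + 1 / 80 : ℝ) := (Real.rpow_pos_of_pos hQ0 _).le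
        calc A ≤ C * (Q : ℝ) ^ (1 + 1 / 80 : ℝ) * ℓ ^ 3 := hAle
          _ ≤ C ^ 4 * (Q : ℝ) ^ (1 + 1 / 80 : ℝ) * ℓ ^ 4 := by gcongr
      calc A ^ (1 / 4 : ℝ) ≤ ((C * (Q : ℝ) ^ ((1 + 1 / 80) / 4 : ℝ) * ℓ) ^ 4) ^ (1 / 4 : ℝ) :=
            Real.rpow_le_rpow hA0.le hAle' (by norm_num)
        _ = C * (Q : ℝ) ^ ((1 + 1 / 80) / 4 : ℝ) * ℓ := by
            rw [show (1 / 4 : ℝ) = ((4 : ℕ) : ℝ)⁻¹ by norm_num]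
            exact Real.pow_rpow_inv_natCast hz0 four_ne_zero
    have hNpow : ((Q ^ 3 : ℕ) : ℝ) ^ (-(3 / 16 : ℝ)) = (Q : ℝ) ^ (-(9 / 16 : ℝ)) := by
      rw [hQcube, ← Real.rpow_mul hQ0.le]; norm_num
    have hQγ : (Q : ℝ) ^ ((1 + 1 / 80) / 4 : ℝ) * (Q : ℝ) ^ (-(9 / 16 : ℝ)) =
        (Q : ℝ) ^ (-((3 : ℕ) * ((99 / 320 : ℝ) / 3))) := by
      rw [← Real.rpow_add hQ0]; norm_num
    have hfin : K * (ℓ ^ 3 * (Q : ℝ) ^ (-((3 : ℕ) * ((99 / 320 : ℝ) / 3)))) < 1 / 25 := by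
      have := mul_lt_mul_of_pos_left hQ3 hK0
      rwa [mul_div_cancel₀ _ hK0.ne'] at this
    rw [hNpow]
    calc 864 * ℓ ^ 2 / (1 / 80) ^ 2 * A ^ (1 / 4 : ℝ) * (Q : ℝ) ^ (-(9 / 16 : ℝ)) * (19 / 3)
        ≤ 864 * ℓ ^ 2 / (1 / 80) ^ 2 * (C * (Q : ℝ) ^ ((1 + 1 / 80) / 4 : ℝ) * ℓ) *
            (Q : ℝ) ^ (-(9 / 16 : ℝ)) * (19 / 3) := by gcongr
      _ = K * (ℓ ^ 3 * ((Q : ℝ) ^ ((1 + 1 / 80) / 4 : ℝ) * (Q : ℝ) ^ (-(9 / 16 : ℝ)))) := by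
          rw [hKdef]; ring
      _ = K * (ℓ ^ 3 * (Q : ℝ) ^ (-((3 : ℕ) * ((99 / 320 : ℝ) / 3)))) := by rw [hQγ]
      _ ≤ 1 / 25 := hfin.le

/-- A real zero `1 − δ` of `L(s, χ)`, `χ ≠ χ₀`, has `δ > 0` (no zeros on `Re s ≥ 1`). [folklore] -/
private theorem pos_of_LFunction_zero' {q : ℕ} [NeZero q] (χ : DirichletCharacter ℂ q) (hχ : χ ≠ 1)
    {δ : ℝ} (hz : χ.LFunction ((1 - δ : ℝ) : ℂ) = 0) : 0 < δ := by
  by_contra h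
  push Not at h
  exact DirichletCharacter.LFunction_ne_zero_of_one_le_re χ (Or.inl hχ)
    (by simp only [Complex.ofReal_re]; linarith) hz

/-- Real primitive characters with distinct value functions have `χ₁χ₂ (mod D₁D₂)` non-principal
(Pintz: "`χ₁ ≠ χ₂` … `χ₁χ₂` a real non-principal character", p. 94; tree
`DirichletZFR.prodChar_ne_one_of_isPrimitive` for `D₁ ≠ D₂`). [cite: Pintz1977ElementaryVIII, §4 p. 94] -/
theorem prodChar_ne_one_of_ne {D₁ D₂ : ℕ} [NeZero D₁] [NeZero D₂] (χ₁ : DirichletCharacter ℂ D₁)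
    (χ₂ : DirichletCharacter ℂ D₂) (hχ₁p : χ₁.IsPrimitive) (hχ₂p : χ₂.IsPrimitive)
    (hq₁ : χ₁ ^ 2 = 1) (hq₂ : χ₂ ^ 2 = 1) (hne : (fun n : ℕ ↦ χ₁ n) ≠ fun n : ℕ ↦ χ₂ n) :
    prodChar χ₁ χ₂ ≠ 1 := by
  by_cases hD : D₁ = D₂
  · subst hD
    intro hψ1
    apply hne
    have hmul : χ₁ * χ₂ = 1 := by
      have hinj := DirichletCharacter.changeLevel_injective (R := ℂ) (dvd_mul_right D₁ D₁)
      apply hinj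
      rw [map_mul, map_one]
      exact hψ1
    have hinv : χ₁⁻¹ = χ₁ := by rw [inv_eq_iff_mul_eq_one, ← sq, hq₁]
    have h12 : χ₁ = χ₂ := by
      calc χ₁ = χ₁⁻¹ := hinv.symm
        _ = χ₂ := inv_eq_of_mul_eq_one_right hmul
    rw [h12]
  · exact DirichletZFR.prodChar_ne_one_of_isPrimitive χ₁ hχ₁p χ₂ hχ₂p hq₂ hD

/-- **(2.2) from (2.1) and Hecke's theorem** (p. 97: "As `ε/7D^ε ≤ 1/(7e log D) < 1/log D` and
`e^{3/2} < 5` on applying Theorem 2 (2.2) follows directly from (4.9)"): for `D ≥ ⌈e^{10000}⌉`,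
`χ` quadratic non-principal mod `D`, `ε > 0` and `L(σ, χ) ≠ 0` on `[1 − ε/(7D^ε), 1]`:
`L(1, χ) > ε/(35 D^ε)` (tree: `re_LFunction_one_ge_of_forall_ne_zero`, `0.29 β ≤ L(1, χ)`).
[cite: Pintz1977ElementaryVIII, Theorem 6 (2.2) p. 90, proof p. 97] -/
theorem re_LFunction_one_gt_of_zeroFree {D : ℕ} [NeZero D] (hD : ⌈Real.exp 10000⌉₊ ≤ D)
    (χ : DirichletCharacter ℂ D) (hq : χ ^ 2 = 1) (hχ : χ ≠ 1) {ε : ℝ} (hε0 : 0 < ε)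
    (hz : ∀ σ : ℝ, 1 - ε / (7 * (D : ℝ) ^ ε) ≤ σ → σ ≤ 1 → χ.LFunction (σ : ℂ) ≠ 0) :
    ε / (35 * (D : ℝ) ^ ε) < (χ.LFunction 1).re := by
  have hDexp : Real.exp 10000 ≤ (D : ℝ) := (Nat.le_ceil _).trans (by exact_mod_cast hD)
  have hD1 : (1 : ℝ) < D :=
    lt_of_lt_of_le (by have := Real.add_one_le_exp (10000 : ℝ); linarith) hDexp
  have hD0 : (0 : ℝ) < D := by linarith
  have hlogD : 0 < Real.log D := Real.log_pos hD1
  have hDε : 0 < (D : ℝ) ^ ε := Real.rpow_pos_of_pos hD0 _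
  set b : ℝ := ε / (7 * (D : ℝ) ^ ε) with hb
  have hb0 : 0 < b := by positivity
  have hexp1 : (2.7 : ℝ) < Real.exp 1 := lt_trans (by norm_num) Real.exp_one_gt_d9
  have hb1 : b ≤ 1 / Real.log D := by
    have h := mul_rpow_neg_le_inv_log hε0 hD1
    rw [Real.rpow_neg hD0.le] at h
    have e1 : b = 1 / 7 * (ε * ((D : ℝ) ^ ε)⁻¹) := by rw [hb]; field_simp
    rw [e1]
    calc 1 / 7 * (ε * ((D : ℝ) ^ ε)⁻¹) ≤ 1 / 7 * (1 / (Real.exp 1 * Real.log D)) :=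
          mul_le_mul_of_nonneg_left h (by norm_num)
      _ ≤ 1 / (Real.exp 1 * Real.log D) := by
          have : 0 ≤ 1 / (Real.exp 1 * Real.log D) := by positivity
          linarith
      _ ≤ 1 / Real.log D :=
          one_div_le_one_div_of_le hlogD (le_mul_of_one_le_left hlogD.le (by linarith))
  have hL := re_LFunction_one_ge_of_forall_ne_zero hD χ hq hχ hb0 hb1 hz
  have : ε / (35 * (D : ℝ) ^ ε) < 29 / 100 * b := by
    rw [hb, show 29 / 100 * (ε / (7 * (D : ℝ) ^ ε)) = ε / (7 * (D : ℝ) ^ ε / (29 / 100)) by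
      field_simp]
    exact div_lt_div_of_pos_left hε0 (by positivity) (by nlinarith)
  linarith

end TatuzawaAssembly

end Pintz1977RealZeros

/-! ## Part E. The discharges: Theorem 6, and Theorems 7a–7b by the landed bridges -/

section Discharge

open DirichletAbel RealChar SiegelCoefficients Pintz1977RealZeros

/-- **Pintz 1977 (VIII), Theorem 6 (Tatuzawa, constants `1/7` and `1/35`) — PROVED.** There is an
absolute `D₀` such that for `0 < ε ≤ 1/5`, with the possible exception of one real primitive
character (one value function), every real primitive `χ mod D`, `D ≥ D₀`, has `L(s, χ) ≠ 0` on
`[1 − ε/(7D^ε), 1]` and `L(1, χ) > ε/(35 D^ε)`. Proof as printed (pp. 96–97): the exception is the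
(value function of a) character `χ₁` of minimal modulus `D₁ ≥ D₀` with a zero in
`[1 − ε/(7D₁^ε), 1]`; any other `χ mod D` (`D ≥ D₀`) with a zero `1 − δ` in its interval has
`D ≥ D₁` by minimality and then `δ > ε/(7D^ε)` by `tatuzawa_core` ((4.6) = Theorem 5 with
`c′ ≥ 1/3`, (4.7), (4.9)) — a contradiction; (2.2) then follows from Hecke's theorem (Theorem 2,
tree `re_LFunction_one_ge_of_forall_ne_zero`). `D₀` is the maximum of the threshold of Theorem 5
(`η = 2/3`), of the window conditions at `x = D³`, and of Hecke's `⌈e^{10000}⌉`.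
[cite: Pintz1977ElementaryVIII, Theorem 6 p. 90; proof pp. 96–97] -/
theorem pintz1977RealZeros_theorem6_holds : pintz1977RealZeros_theorem6 := by
  classical
  obtain ⟨A₀, hA₀⟩ := pintz1977RealZeros_theorem5_holds (2 / 3) (by norm_num)
  obtain ⟨Q₀, hQ₀⟩ := exists_tatuzawa_conditions_nat
  set D₀ : ℕ := max (max A₀ Q₀) (max ⌈Real.exp 10000⌉₊ 2) with hD₀def
  have hD₀A : A₀ ≤ D₀ := le_trans (le_max_left _ _) (le_max_left _ _)
  have hD₀Q : Q₀ ≤ D₀ := le_trans (le_max_right _ _) (le_max_left _ _)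
  have hD₀H : ⌈Real.exp 10000⌉₊ ≤ D₀ := le_trans (le_max_left _ _) (le_max_right _ _)
  have hD₀2 : 2 ≤ D₀ := le_trans (le_max_right _ _) (le_max_right _ _)
  refine ⟨D₀, fun ε hε hε5 => ?_⟩
  -- (2.2) from (2.1), for any admissible character
  have hecke : ∀ {q : ℕ} [NeZero q] (χ : DirichletCharacter ℂ q), χ.IsQuadratic → χ ≠ 1 → D₀ ≤ q →
      (∀ σ : ℝ, 1 - ε / (7 * (q : ℝ) ^ ε) ≤ σ → σ ≤ 1 → χ.LFunction (σ : ℂ) ≠ 0) →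
      ε / (35 * (q : ℝ) ^ ε) < (χ.LFunction 1).re :=
    fun χ hχq hχ1 hq hzf =>
      re_LFunction_one_gt_of_zeroFree (hD₀H.trans hq) χ (MulChar.isQuadratic_iff_sq_eq_one.mp hχq)
        hχ1 hε hzf
  -- the moduli carrying a real primitive character with a zero in `[1 − ε/(7D^ε), 1]`
  let P : ℕ → Prop := fun D => D₀ ≤ D ∧ ∃ (_ : NeZero D) (χ : DirichletCharacter ℂ D),
    χ.IsPrimitive ∧ χ.IsQuadratic ∧ χ ≠ 1 ∧
      ∃ σ : ℝ, 1 - ε / (7 * (D : ℝ) ^ ε) ≤ σ ∧ σ ≤ 1 ∧ χ.LFunction (σ : ℂ) = 0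
  by_cases hex : ∃ D, P D
  · -- the exceptional character: minimal modulus
    set D₁ : ℕ := Nat.find hex with hD₁def
    have hspec : P D₁ := Nat.find_spec hex
    obtain ⟨hD₁D₀, inst₁, χ₁, hχ₁p, hχ₁q, hχ₁1, σ₁, hσ₁lo, hσ₁hi, hzσ₁⟩ := hspec
    refine ⟨fun n : ℕ => χ₁ n, fun q _ χ hχp hχq hχ1 hne hq => ?_⟩
    have hzf : ∀ σ : ℝ, 1 - ε / (7 * (q : ℝ) ^ ε) ≤ σ → σ ≤ 1 → χ.LFunction (σ : ℂ) ≠ 0 := by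
      intro σ hσlo hσhi hzero
      have hPq : P q := ⟨hq, ⟨inferInstance, χ, hχp, hχq, hχ1, σ, hσlo, hσhi, hzero⟩⟩
      have hD₁q : D₁ ≤ q := Nat.find_min' hex hPq
      -- the data for `tatuzawa_core` with `(χ₁, D₁, γ = 1 − σ₁)` and `(χ, q, δ = 1 − σ)`
      have hq₁ : χ₁ ^ 2 = 1 := MulChar.isQuadratic_iff_sq_eq_one.mp hχ₁q
      have hq₂ : χ ^ 2 = 1 := MulChar.isQuadratic_iff_sq_eq_one.mp hχq
      have hne' : (fun n : ℕ ↦ χ₁ n) ≠ fun n : ℕ ↦ χ n := fun h => hne h.symm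
      have hψ : prodChar χ₁ χ ≠ 1 := prodChar_ne_one_of_ne χ₁ χ hχ₁p hχp hq₁ hq₂ hne'
      have hzγ : χ₁.LFunction ((1 - (1 - σ₁) : ℝ) : ℂ) = 0 := by
        rw [show (1 - (1 - σ₁) : ℝ) = σ₁ by ring]; exact hzσ₁
      have hzδ : χ.LFunction ((1 - (1 - σ) : ℝ) : ℂ) = 0 := by
        rw [show (1 - (1 - σ) : ℝ) = σ by ring]; exact hzero
      have hγ0 : 0 < 1 - σ₁ := pos_of_LFunction_zero' χ₁ hχ₁1 hzγ
      have hδ0 : 0 < 1 - σ := pos_of_LFunction_zero' χ hχ1 hzδ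
      have hγ : 1 - σ₁ ≤ ε / (7 * (D₁ : ℝ) ^ ε) := by linarith
      -- sizes
      have hD₁2 : 2 ≤ D₁ := hD₀2.trans hD₁D₀
      have hq2 : 2 ≤ q := hD₀2.trans hq
      have hD₁1 : (1 : ℝ) ≤ D₁ := by exact_mod_cast (le_trans one_le_two hD₁2)
      have hq1r : (1 : ℝ) ≤ q := by exact_mod_cast (le_trans one_le_two hq2)
      set Q : ℕ := D₁ * q with hQdef
      haveI : NeZero Q := ⟨Nat.mul_ne_zero (NeZero.ne D₁) (NeZero.ne q)⟩
      have hQq : q ≤ Q := Nat.le_mul_of_pos_left q (lt_of_lt_of_le (by norm_num) hD₁2)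
      have hQ₀Q : Q₀ ≤ Q := hD₀Q.trans (hq.trans hQq)
      have hA₀Q : A₀ ≤ D₁ * q := hD₀A.trans (hq.trans hQq)
      obtain ⟨hQ7, hAN, hEN⟩ := hQ₀ Q hQ₀Q
      have hQprod : (Q : ℝ) = (D₁ : ℝ) * q := by rw [hQdef]; push_cast; ring
      have hQ0r : (0 : ℝ) < Q := by rw [hQprod]; positivity
      have hQ1r : (1 : ℝ) ≤ Q := by
        rw [hQprod]; exact one_le_mul_of_one_le_of_one_le hD₁1 hq1r
      have hlogQ0 : 0 ≤ Real.log Q := Real.log_nonneg hQ1r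
      set ℓ : ℝ := 1 + Real.log Q with hℓdef
      have hℓ1 : 1 ≤ ℓ := by rw [hℓdef]; linarith only [hlogQ0]
      have hlogD₁ : Real.log D₁ ≤ Real.log Q := by
        refine Real.log_le_log (by linarith only [hD₁1]) ?_
        rw [hQprod]; exact le_mul_of_one_le_right (by linarith only [hD₁1]) hq1r
      have hlogq : Real.log q ≤ Real.log Q := by
        refine Real.log_le_log (by linarith only [hq1r]) ?_
        rw [hQprod]; exact le_mul_of_one_le_left (by linarith only [hq1r]) hD₁1
      have hlogD₁0 : 0 ≤ Real.log D₁ := Real.log_nonneg hD₁1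
      have hlogq0 : 0 ≤ Real.log q := Real.log_nonneg hq1r
      have hℓD₁ : 1 + Real.log D₁ ≤ ℓ := by rw [hℓdef]; linarith only [hlogD₁]
      have hℓq : 1 + Real.log q ≤ ℓ := by rw [hℓdef]; linarith only [hlogq]
      have hA₁ : ∀ n, ‖partialSum χ₁ n‖ ≤ Real.sqrt D₁ * ℓ := fun n =>
        (norm_partialSum_le_polyaVinogradov χ₁ hD₁2 hχ₁p n).trans
          (mul_le_mul_of_nonneg_left hℓD₁ (Real.sqrt_nonneg _))
      have hA₂ : ∀ n, ‖partialSum χ n‖ ≤ Real.sqrt q * ℓ := fun n =>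
        (norm_partialSum_le_polyaVinogradov χ hq2 hχp n).trans
          (mul_le_mul_of_nonneg_left hℓq (Real.sqrt_nonneg _))
      have hA₃ : ∀ n, ‖partialSum (prodChar χ₁ χ) n‖ ≤
          ((ArithmeticFunction.sigma 0 Q : ℕ) : ℝ) * Real.sqrt Q * ℓ := by
        intro n
        rw [partialSum_eq_sum_Ioc]
        exact Literature.NumberTheory.Sieve.FriedlanderIwaniecPrimes.norm_sum_Ioc_le_of_ne_one hψ 0 (0 + n)
      have hL₁ : ‖χ₁.LFunction 1‖ ≤ ℓ :=
        (norm_LFunction_one_le_log χ₁ hχ₁1).trans (by linarith only [hℓD₁, hlogD₁0])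
      have hL₂ : ‖χ.LFunction 1‖ ≤ ℓ :=
        (norm_LFunction_one_le_log χ hχ1).trans (by linarith only [hℓq, hlogq0])
      have hsqD₁ : 1 ≤ Real.sqrt D₁ := Real.one_le_sqrt.mpr hD₁1
      have hsqq : 1 ≤ Real.sqrt q := Real.one_le_sqrt.mpr hq1r
      have hsqQ : 1 ≤ Real.sqrt Q := Real.one_le_sqrt.mpr hQ1r
      have hτ1 : (1 : ℝ) ≤ ((ArithmeticFunction.sigma 0 Q : ℕ) : ℝ) := by
        have : 0 < ArithmeticFunction.sigma 0 Q := by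
          rw [ArithmeticFunction.sigma_zero_apply]
          exact Finset.card_pos.mpr ⟨1, Nat.one_mem_divisors.mpr (NeZero.ne Q)⟩
        exact_mod_cast this
      have hA₁1 : 1 ≤ Real.sqrt D₁ * ℓ := one_le_mul_of_one_le_of_one_le hsqD₁ hℓ1
      have hA₂1 : 1 ≤ Real.sqrt q * ℓ := one_le_mul_of_one_le_of_one_le hsqq hℓ1
      have hA₃1 : 1 ≤ ((ArithmeticFunction.sigma 0 Q : ℕ) : ℝ) * Real.sqrt Q * ℓ :=
        one_le_mul_of_one_le_of_one_le (one_le_mul_of_one_le_of_one_le hτ1 hsqQ) hℓ1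
      have hAeq : Real.sqrt D₁ * ℓ * (Real.sqrt q * ℓ) *
          (((ArithmeticFunction.sigma 0 Q : ℕ) : ℝ) * Real.sqrt Q * ℓ) =
          ((ArithmeticFunction.sigma 0 Q : ℕ) : ℝ) * Q * ℓ ^ 3 := by
        have h12 : Real.sqrt D₁ * Real.sqrt q = Real.sqrt Q := by
          rw [← Real.sqrt_mul (by linarith only [hD₁1]), hQprod]
        have hQQ : Real.sqrt Q * Real.sqrt Q = Q := Real.mul_self_sqrt hQ0r.le
        calc Real.sqrt D₁ * ℓ * (Real.sqrt q * ℓ) *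
            (((ArithmeticFunction.sigma 0 Q : ℕ) : ℝ) * Real.sqrt Q * ℓ)
            = ((ArithmeticFunction.sigma 0 Q : ℕ) : ℝ) * ((Real.sqrt D₁ * Real.sqrt q) *
                Real.sqrt Q) * ℓ ^ 3 := by ring
          _ = ((ArithmeticFunction.sigma 0 Q : ℕ) : ℝ) * Q * ℓ ^ 3 := by rw [h12, hQQ]
      have hNA : Real.sqrt D₁ * ℓ * (Real.sqrt q * ℓ) *
          (((ArithmeticFunction.sigma 0 Q : ℕ) : ℝ) * Real.sqrt Q * ℓ) ≤ (((D₁ * q) ^ 3 : ℕ) : ℝ) := by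
        rw [hAeq]; exact hAN
      have hE : 864 * ℓ ^ 2 / (1 / 80) ^ 2 * (Real.sqrt D₁ * ℓ * (Real.sqrt q * ℓ) *
          (((ArithmeticFunction.sigma 0 Q : ℕ) : ℝ) * Real.sqrt Q * ℓ)) ^ (1 / 4 : ℝ) *
          (((D₁ * q) ^ 3 : ℕ) : ℝ) ^ (-(3 / 16 : ℝ)) * (19 / 3) ≤ 1 / 25 := by
        rw [hAeq]
        exact hEN
      -- (4.6): Theorem 5 with `c′ ≥ 1/3`
      have h5' := hA₀ D₁ q hA₀Q χ₁ χ hχ₁q hχ₁p hχq hχp hne' (1 - σ₁) (1 - σ) hzγ hzδ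
      have h5 : 1 / (3 * Real.log ((D₁ * q : ℕ) : ℝ)) < max (1 - σ₁) (1 - σ) := by
        have e : 1 / (3 * Real.log ((D₁ * q : ℕ) : ℝ)) = (1 - 2 / 3) / Real.log ((D₁ : ℝ) * q) := by
          push_cast; ring
        rw [e]; exact h5'
      have hcore := tatuzawa_core χ₁ χ hχ₁1 hq₁ hχ1 hq₂ hψ hA₁1 hA₂1 hA₃1 hℓ1 hA₁ hA₂ hA₃ hL₁ hL₂
        hD₁q hQ7 hNA hE hε hε5 hγ0 hγ hδ0 hzγ hzδ h5
      linarith only [hcore, hσlo]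
    exact ⟨hzf, hecke χ hχq hχ1 hq hzf⟩
  · -- no exceptional character at all
    refine ⟨fun _ => 0, fun q _ χ hχp hχq hχ1 _ hq => ?_⟩
    have hzf : ∀ σ : ℝ, 1 - ε / (7 * (q : ℝ) ^ ε) ≤ σ → σ ≤ 1 → χ.LFunction (σ : ℂ) ≠ 0 :=
      fun σ hσlo hσhi hzero => hex ⟨q, hq, ⟨inferInstance, χ, hχp, hχq, hχ1, σ, hσlo, hσhi, hzero⟩⟩
    exact ⟨hzf, hecke χ hχq hχ1 hq hzf⟩

/-- **Pintz 1977 (VIII), Theorem 7, (2.3) — PROVED**: `h(−D) > (ε/35π) D^{1/2−ε}` for fundamental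
discriminants `−D < 0`, `D > D₀`, with at most one exception (by the landed bridge
`theorem7a_of_theorem6`: Dirichlet's class number formula). [cite: Pintz1977ElementaryVIII, Theorem 7 (2.3) p. 91] -/
theorem pintz1977RealZeros_theorem7a_holds : pintz1977RealZeros_theorem7a :=
  Pintz1977RealZeros.theorem7a_of_theorem6 pintz1977RealZeros_theorem6_holds

/-- **Pintz 1977 (VIII), Theorem 7, (2.4) — PROVED**: if `h ≥ 1`, `D ≥ (2000 h (log h + 10))²` and
`D > D₀` then `h(−D) > h`, with at most one exceptional fundamental discriminant (by the landed
bridge `theorem7b_of_theorem7a`). [cite: Pintz1977ElementaryVIII, Theorem 7 (2.4) p. 91] -/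
theorem pintz1977RealZeros_theorem7b_holds : pintz1977RealZeros_theorem7b :=
  Pintz1977RealZeros.theorem7b_of_theorem7a pintz1977RealZeros_theorem7a_holds

end Discharge

end Literature.NumberTheory.LFunctions
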